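import Literature.MathematicalPhysics.QuantumFieldTheory.Balaban1983to89.T4PartnerMultiplicity

/-!
# `Balaban1983to89.T4BranchingRecordsGas` — the BRANCHING RECORDS COUNT: pending histories counted as GENEALOGY
TREES over class labels (no distinctness of labels), the partner multiplicity carried as an AGE FACTOR, the ROOT RATE
unchanged; the count member's chain re-seamed through a labelling binder over branching records (cell `pub-balaban`,
T4-DAG §5 self-row T4-U5c.E-NE7b-BRANCH-K* (§8 Q24(a)), node U5c / U5.E, spine estimate NE7b, COUNT member P1
«Peierls / entropy–energy counting of persistent large-field histories», gen 13; record `t4/T4-EST-NE7b-P1.md` v1.13;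
kernel bookkeeping — finite combinatorics + real arithmetic; imports `T4PartnerMultiplicity` (this lineage, v1 p191685)
and, through it, `T4LiveGasToTerms` (renewal member t4-ne7b-p2, v1.1) BY NAME and modifies nothing; it DERIVES the
instance `DecidableEq (Gen ε)` for the dictionary's genealogy type (a later module needing it imports this one).
VERSION v1 = this file.)

HONEST FRAMING (T4-DAG PAGE 1).  The cell's T4 target is the existence and uniqueness of the `ε → 0` limit of unit-scale
block-averaged expectations on a FIXED finite torus, at rung (B)+1, CONDITIONAL on Bałaban's ultraviolet stability (B)
and on BetaPertH; it is NOT infinite volume, NOT the mass gap, NOT the Clay problem.  This module is [folklore] finite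
combinatorics and real analysis.  NOTHING of Bałaban's is asserted or quoted: no sentence of [Balaban1989LargeFieldII]
(cell paper B16, CMP 122 (1989) 355–392) or of [Balaban1988Convergent] (B14, CMP 119 (1988) 243–285) is a hypothesis of
anything here.  (B), BetaPertH, (B^μ), the reading (ID), the menus and the four budgets of the count are DISPLAYED
BINDERS of the theorems below, exactly as in `T4RecordPriceSeam` / `T4PartnerMultiplicity` — none is hidden in a
definition.  Value = a kernel certificate about OUR OWN counting chain; NOT an estimate of Bałaban's expansion; NOT
summit progress; NOT a proof of NE7b.

THE LOCATED POINT (count side; GAPS G-ne7bp1g12-1 (LM), symptoms (i) and (iii)).  Every earlier count of this lineage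
(`T4PersistentHistoryCount.records`, carried through `T4LiveStructureGas`, `T4RecordPriceSeam`, `T4PartnerMultiplicity`)
indexes a pending history by a FLAT record: root event `b` and the SET `Q ⊆ E K j` of its later events, and prices it
through ONE well-formed genealogy `G` with `(events G).erase root = Q`.  `Gen.WF` forces the events of the two partners
of a merger to be DISJOINT, so two branches renewing at the same step with the same class — the generic situation for
parallel sub-structures of equal fatness — have NO well-formed genealogy over class labels (§8 `Z_not_WF`), and any
repair by disambiguating tags makes the label universe, hence the budget `η̄`, depend on `K` / on the volume (record §5
(x), dead ends).  THIS MODULE replaces the flat record by the genealogy TERM itself: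
  §1 TREE WEIGHTS.  `npAll η G` / `npNR η G`: the product of `η` over ALL nodes of the term / all but the ROOT birth —
     structural recursion, multiplicity included, no `WF`; `npAll = η root · npNR`; under `WF` they are the products over
     `events` / `events ∖ root` (`npAll_eq_prod`, `npNR_eq_prod_erase`).  `treeWt ρ η θ st G := ρ root · θ^{partnerAges st G}
     · npNR η G` with an AGE FACTOR `θ` per unit of partner age; `relabel f` and its pull-backs (`treeWt_relabel`).
  §2 THE BRANCHING RECORDS.  `fam Lren Lmer Lpart n Lb s K`: the finite family of genealogy terms of fuel `≤ n` whose
     root birth is drawn from `Lb` at step `s`, with events at steps `≤ K`, renewals at steps `t ∈ (s, K]` from the menu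
     `Lren t` (readiness `t − 1`), mergers at `t ∈ (s, K]` from `Lmer t` joining — OLDER LINE FIRST — a partner sub-tree
     born at `s′ ∈ [s, t]` from `Lpart s′`; TIME-SLICED: the sub-trees under an event at step `t` have events `≤ t` (the
     permissive variant diverges — dead end).  `born/renew/merge_mem_fam`, `fam_cases`, `rootStep_of_mem_fam`,
     `root_mem_of_mem_fam`, monotonicity in fuel and horizon.
  §3 THE COUNT.  `famSum_le`: `Σ_{G ∈ fam n Lb s K} treeWt ρ η θ st G ≤ (Σ_{b ∈ Lb} ρ b) · φ^{K − s}` for EVERY fuel, by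
     induction on `n`, under per-step menu budgets `Σ_{Lren t} η ≤ a`, `Σ_{Lmer t} η ≤ μ`, `Σ_{Lpart s′} η ≤ ν`, an age
     series bound `Σ_{s′ ∈ [s,t]} θ^{t+1−s′} φ^{t−s′} ≤ Γ` and the fixed-point side condition `(a + μνΓ)·φ ≤ φ − 1`
     (`one_add_mul_geom_le`: `1 + x·Σ_{t ∈ (s,K]} φ^{t−s} ≤ φ^{K−s}` when `xφ ≤ φ − 1`).
  §4 THE RATES.  `ageSeries_le`: `Γ = θ/(1 − θφ)` for `θφ < 1`; `famSum_le_exp` (`φ = e^{η̄₊}`); `twoRate_eq`;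
     `bslotPriceT_le`: prices `y G ≤ e^{−κ₁ (K + 1 − j)} · treeWt` on `fam n Lb j K` with `Σ_{Lb} ρ ≤ ρ̄` sum to
     `≤ ρ̄ · e^{−κ₁} · (e^{η̄₊ − κ₁})^{K − j}` — the per-slot shape of `slotPrice_le` / `slotPriceT_le` VERBATIM with `η̄₊`
     for `η̄`.  Hence the ROOT RATE `Λ · e^{η̄₊ − κ₁} < 1` (threshold arithmetic of NE7b untouched) and a PARTNER RATE
     `θ · e^{η̄₊} < 1`, `θ = Λ′ · e^{−κ₁}` in the model — against `Λ′ · e^{−κ₁} ≤ 1` in `T4PartnerMultiplicity` and against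
     the κ₁-shift `Λ · Λ′ · e^{η̄ − κ₁} < 1` (threshold doubled) of the naive repair.
  §5 SLOTS, MASSES, COMPOSITION BY NAME.  `BSlot γ δ = (j, z, G)`; `bliveSlots` / `boldSlots` / `bslotPrice`;
     `bliveMass_le_of_slotBound` / `boldMass_le_of_slotBound` (cell sums as in `T4PartnerMultiplicity` §3); `runFam`;
     `exists_relWeightBound_of_regeneration_branchingGasRun` = the renewal member's ABSTRACT
     `T4LiveGasToTerms.exists_relWeightBound_of_regeneration_liveGas` with the branching slots ⇒ `∃ K₁ ≥ K₀,
     RelWeightBound …` with budget `𝟙_{K ≥ K₁} · C · recordsBudget ρ̄ κ₁ V Λ η̄₊ j⋆` — the SAME budget function as every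
     earlier seam (`summable_recordsBudget` reused as is).
  §6 THE BRIDGE AND THE SEAM.  `treeShape_of_mulRawShape` (generic): for a well-formed `G` pending at `K` with
     `partnerAges ≤ windowSurplus`, a price `≤ M^{partnerAges} ·` (record shape of the seam) is `≤ e^{−κ₁ (K + 1 − rootStep)}
     · treeWt ρ η (M · e^{−κ₁}) st G` — the surplus credits, DISCARDED by the records count and used only to KILL `Λ′` in
     `T4PartnerMultiplicity.mulFactor_le`, are CARRIED as the age factor; no smallness of `M`.  On the dictionary:
     `treeShape_of_labelB` (`price_le_shape` + `partnerAges_le_windowSurplus` + the bridge), the class SHAPE of an event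
     (`shape`: renewals / mergers keep `(step, kind)` only; `rho_shape`, `eta_shape`, `treeWt_relabel_shape`), and
     `treeShape_of_label` = the labelling binder `hlabB` at one slot: `y ≤ 0 ∨ ∃ G̃ consistent, well formed, K < reach G̃,
     relabel shape G̃ = G, y ≤ Λ′^{partnerAges G̃} · e^{−credits G̃} · e^{+lifeCost G̃}`.
  §7 END TO END.  `exists_relWeightBound_of_bankingB`, `exists_irThreshold_relWeightBoundB` =
     `T4PartnerMultiplicity.exists_relWeightBound_of_bankingM` / `exists_irThreshold_relWeightBoundM` with: live slots ↦
     branching slots over displayed menus `Lroot Lren Lmer Lpart` (per cutoff) and fuel `Ncap`; `hlabM` ↦ `hlabB`; budgets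
     `ρ̄, η̄` ↦ `ρ̄, a, μ, ν` with `η̄₊ ≥ 0`, `Λ′e^{−C.κ₁}e^{η̄₊} < 1` and the fixed-point side condition; the binder
     `Λ′ · e^{−C.κ₁} ≤ 1` DROPPED; same flow hypotheses, same ONE infrared threshold `x₀`, same root rate, same conclusion.
  §8 SANITY (by `simp` / `norm_num`): the two-branch history `Z = renew (merge X Y (4,2,0)) (6,1,0) 5`, whose branches
     `X`, `Y` renew at the SAME step `3` with the SAME label `(3,1,0)`, lies in `fam (n + 4) {(0,0,1)} 0 8` for every `n`
     and is NOT `WF` for any window table; its tree weight (`θ^4`, the repeated label twice); the menus `{(t,1,0)}`,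
     `{(t,2,0)}` have budgets `e^{−E₀}` (`eta_renew` / `eta_merge`); the side conditions at `a = μ = ν = θ = 1/10`, `φ = 2`;
     and the count at these numbers: `Σ_{fam n Lb 0 K} treeWt ≤ 2^K` for every fuel `n` and horizon `K`.
WHAT THIS DOES NOT DO.  (i) It does not discharge `hlabB`: that every pending structure of cutoff `K` is priced by SOME
consistent genealogy over the dictionary whose shape lies in `runFam` (time-ordered, older line first, fuel `≤ Ncap K`,
roots / partners from the menus) with multiplicity `Λ′^{partnerAges}` is the READING (ID) plus the GEOMETRIC multiplicity
statement of GAPS G-ne7bp1g9-1 / G-ne7bp1g12-1 (GM) (owner O-R10) — displayed, binder shape unchanged.  (ii) It does not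
repair symptom (ii) of G-ne7bp1g12-1 (LM) on the PRICE side: `hlabB` still asks `G̃.WF (dictW …)` of a genealogy over
`PEv`, and two parallel BIRTHS of equal step and class collide there; the fix is `T4PrintedShapeBanking` /
`T4BankedInduction` generic over a tagged label type (owner: this lineage, next generation) — the count of THIS module is
already over shapes and will not change.  (iii) The budgets `hρbar`, `ha`, `hμ`, `hν` and the fuel `Ncap` are displayed,
not derived (for the one-label menus of §8, `a = μ = e^{−E₀}`).  (iv) It does not touch the typed flow, the infrared
smallness, `Regeneration`, the domination `hF`, (G2)/(G5), or any module of another seat.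

References (locators only, nothing quoted): [Balaban1989LargeFieldII] (1.79) p. 383, (1.82) p. 385, (1.84)–(1.89)
pp. 385–388; [Balaban1988Convergent] (2.5), (2.7) p. 255, (2.9) p. 256 — as typed in `B14` / `B14FlowStep` and read in
`T4PrintedShapeBanking` / `T4PersistenceDictionary` / `T4LiveStructureGas` / `T4RecordPriceSeam` / `T4PartnerMultiplicity`.
-/

open Finset

namespace Literature.MathematicalPhysics.QuantumFieldTheory.Balaban1983to89

-- genealogies have decidable equality (derived; needed to form finite families of genealogy TERMS)
deriving instance DecidableEq for T4PersistenceDictionary.Gen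

namespace T4BranchingRecordsGas

open T4PersistenceDictionary T4PersistentHistoryCount T4BankedInduction T4PrintedShapeBanking
open T4WeightBudget T4GlobalDenominator T4LiveClassFibration T4LiveStructureGas T4LiveGasToTerms T4RecordPriceSeam
open T4PartnerMultiplicity

/-! ## §1 Tree weights of a genealogy; relabelling -/

section Trees

variable {δ ε : Type*}

/-- **THE FULL NODE PRODUCT**: the product of the weights `η` over ALL events of the genealogy read as a TREE (every
constituent's birth, every renewal, every merger) — a structural recursion, no distinctness of labels needed. [folklore] -/
def npAll (η : δ → ℝ) : Gen δ → ℝ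
  | Gen.born b _ => η b
  | Gen.renew G e _ => npAll η G * η e
  | Gen.merge X Y e => npAll η X * npAll η Y * η e

/-- **THE NON-ROOT NODE PRODUCT**: the same product with the ROOT birth (`Gen.root`: the earliest-born constituent, ties
towards the first partner) left out — its weight is the birth residual `ρ`, booked separately. [folklore] -/
def npNR (η : δ → ℝ) : Gen δ → ℝ
  | Gen.born _ _ => 1
  | Gen.renew G e _ => npNR η G * η e
  | Gen.merge X Y e => (if X.rootStep ≤ Y.rootStep then npNR η X * npAll η Y else npAll η X * npNR η Y) * η e

/-- full node product of a bare birth [folklore] -/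
@[simp] theorem npAll_born (η : δ → ℝ) (b : δ) (j : ℕ) : npAll η (Gen.born b j) = η b := rfl
/-- full node product after a renewal [folklore] -/
@[simp] theorem npAll_renew (η : δ → ℝ) (G : Gen δ) (e : δ) (h : ℕ) :
    npAll η (Gen.renew G e h) = npAll η G * η e := rfl
/-- full node product after a merger [folklore] -/
@[simp] theorem npAll_merge (η : δ → ℝ) (X Y : Gen δ) (e : δ) :
    npAll η (Gen.merge X Y e) = npAll η X * npAll η Y * η e := rfl
/-- non-root node product of a bare birth [folklore] -/
@[simp] theorem npNR_born (η : δ → ℝ) (b : δ) (j : ℕ) : npNR η (Gen.born b j) = 1 := rfl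
/-- non-root node product after a renewal [folklore] -/
@[simp] theorem npNR_renew (η : δ → ℝ) (G : Gen δ) (e : δ) (h : ℕ) :
    npNR η (Gen.renew G e h) = npNR η G * η e := rfl
/-- non-root node product after a merger [folklore] -/
theorem npNR_merge (η : δ → ℝ) (X Y : Gen δ) (e : δ) :
    npNR η (Gen.merge X Y e) =
      (if X.rootStep ≤ Y.rootStep then npNR η X * npAll η Y else npAll η X * npNR η Y) * η e := rfl

/-- **ROOT × NON-ROOT = ALL**: `npAll η G = η (root G) · npNR η G`. [folklore] -/
theorem npAll_eq_root_mul (η : δ → ℝ) : ∀ G : Gen δ, npAll η G = η G.root * npNR η G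
  | Gen.born b j => by simp
  | Gen.renew G e h => by rw [npAll_renew, npNR_renew, root_renew, npAll_eq_root_mul η G]; ring
  | Gen.merge X Y e => by
      rw [npAll_merge, npNR_merge, root_merge]
      split_ifs with h
      · rw [npAll_eq_root_mul η X]; ring
      · rw [npAll_eq_root_mul η Y]; ring

/-- the full node product is nonnegative for nonnegative weights [folklore] -/
theorem npAll_nonneg {η : δ → ℝ} (hη : ∀ e, 0 ≤ η e) : ∀ G : Gen δ, 0 ≤ npAll η G
  | Gen.born b j => by simpa using hη b
  | Gen.renew G e h => by rw [npAll_renew]; exact mul_nonneg (npAll_nonneg hη G) (hη e)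
  | Gen.merge X Y e => by
      rw [npAll_merge]; exact mul_nonneg (mul_nonneg (npAll_nonneg hη X) (npAll_nonneg hη Y)) (hη e)

/-- the non-root node product is nonnegative for nonnegative weights [folklore] -/
theorem npNR_nonneg {η : δ → ℝ} (hη : ∀ e, 0 ≤ η e) : ∀ G : Gen δ, 0 ≤ npNR η G
  | Gen.born b j => by simp
  | Gen.renew G e h => by rw [npNR_renew]; exact mul_nonneg (npNR_nonneg hη G) (hη e)
  | Gen.merge X Y e => by
      rw [npNR_merge]
      refine mul_nonneg ?_ (hη e)
      split_ifs
      · exact mul_nonneg (npNR_nonneg hη X) (npAll_nonneg hη Y)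
      · exact mul_nonneg (npAll_nonneg hη X) (npNR_nonneg hη Y)

/-- **THE TREE PRODUCT IS THE FLAT PRODUCT on a well-formed genealogy** (distinct labels): `npAll η G = ∏_{e ∈ events G} η e`.
[folklore] -/
theorem npAll_eq_prod [DecidableEq δ] (η : δ → ℝ) (W : δ → ℕ) : ∀ {G : Gen δ}, G.WF W → npAll η G = ∏ e ∈ G.events, η e
  | Gen.born b j, _ => by simp
  | Gen.renew G e h, hW => by
      have hW' := hW
      simp only [Gen.WF] at hW'
      obtain ⟨hG, he, -, -⟩ := hW'
      rw [Gen.events_renew, Finset.prod_insert he, npAll_renew, npAll_eq_prod η W hG, mul_comm]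
  | Gen.merge X Y e, hW => by
      have hW' := hW
      simp only [Gen.WF] at hW'
      obtain ⟨hX, hY, heX, heY, hdis, -, -⟩ := hW'
      have hmem : e ∉ X.events ∪ Y.events := by simp [heX, heY]
      rw [Gen.events_merge, Finset.prod_insert hmem, Finset.prod_union hdis, npAll_merge, npAll_eq_prod η W hX,
        npAll_eq_prod η W hY]
      ring

/-- **… AND SO IS THE NON-ROOT PRODUCT**: on a well-formed genealogy with `η (root) ≠ 0`,
`npNR η G = ∏_{e ∈ (events G).erase (root G)} η e` — the record product of `T4RecordPriceSeam.price_le_shape`. [folklore] -/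
theorem npNR_eq_prod_erase [DecidableEq δ] (η : δ → ℝ) (W : δ → ℕ) {G : Gen δ} (hW : G.WF W) (h0 : η G.root ≠ 0) :
    npNR η G = ∏ e ∈ G.events.erase G.root, η e := by
  have h1 := npAll_eq_root_mul η G
  have h2 := npAll_eq_prod η W hW
  rw [← Finset.mul_prod_erase G.events η (Gen.root_mem G)] at h2
  exact mul_left_cancel₀ h0 (h1.symm.trans h2)

/-- **THE TREE WEIGHT** of a genealogy in the count's currency: root residual `ρ (root G)`, an AGE FACTOR `θ` per unit
of partner age (`θ ^ partnerAges st G` — in the model `θ = Λ′·e^{−κ₁}`: the partner-position multiplicity `Λ′` of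
`T4PartnerMultiplicity` against the surplus window credit `e^{−κ₁}` of the same step), and the residuals `η` of every
non-root event (`npNR`). [folklore] -/
def treeWt (ρ η : δ → ℝ) (θ : ℝ) (st : δ → ℕ) (G : Gen δ) : ℝ := ρ G.root * θ ^ partnerAges st G * npNR η G

/-- the tree weight unfolded [folklore] -/
theorem treeWt_eq (ρ η : δ → ℝ) (θ : ℝ) (st : δ → ℕ) (G : Gen δ) :
    treeWt ρ η θ st G = ρ G.root * θ ^ partnerAges st G * npNR η G := rfl

/-- the tree weight is nonnegative [folklore] -/
theorem treeWt_nonneg {ρ η : δ → ℝ} {θ : ℝ} (hρ : ∀ b, 0 ≤ ρ b) (hη : ∀ e, 0 ≤ η e) (hθ : 0 ≤ θ) (st : δ → ℕ)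
    (G : Gen δ) : 0 ≤ treeWt ρ η θ st G :=
  mul_nonneg (mul_nonneg (hρ _) (pow_nonneg hθ _)) (npNR_nonneg hη G)

/-- tree weight of a bare birth: the root residual [folklore] -/
@[simp] theorem treeWt_born (ρ η : δ → ℝ) (θ : ℝ) (st : δ → ℕ) (b : δ) (j : ℕ) :
    treeWt ρ η θ st (Gen.born b j) = ρ b := by simp [treeWt]

/-- tree weight after a renewal: one more residual [folklore] -/
@[simp] theorem treeWt_renew (ρ η : δ → ℝ) (θ : ℝ) (st : δ → ℕ) (G : Gen δ) (e : δ) (h : ℕ) :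
    treeWt ρ η θ st (Gen.renew G e h) = treeWt ρ η θ st G * η e := by
  simp [treeWt]; ring

/-- **TREE WEIGHT OF A MERGER, OLDER LINE FIRST**: `treeWt (merge X Y e) = treeWt X · (θ^{st e + 1 − rootStep Y} ·
treeWt_η Y · η e)` when `rootStep X ≤ rootStep Y` — the partner `Y` enters with its OWN birth residual `η (root Y)` as
root weight, its own sub-history, and the age factor of its age at the merger. [folklore] -/
theorem treeWt_merge_of_le (ρ η : δ → ℝ) (θ : ℝ) (st : δ → ℕ) {X Y : Gen δ} (hXY : X.rootStep ≤ Y.rootStep) (e : δ) :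
    treeWt ρ η θ st (Gen.merge X Y e) =
      treeWt ρ η θ st X * (θ ^ (st e + 1 - Y.rootStep) * treeWt η η θ st Y * η e) := by
  simp only [treeWt, root_merge, if_pos hXY, npNR_merge, partnerAges_merge, max_eq_right hXY,
    npAll_eq_root_mul η Y, pow_add]
  ring

/-- **RELABELLING** a genealogy along a map of labels (same tree, same steps; in the model: forgetting a tag / the class
coordinate of renewal and merger labels). [folklore] -/
def relabel (f : ε → δ) : Gen ε → Gen δ
  | Gen.born b j => Gen.born (f b) j
  | Gen.renew G e h => Gen.renew (relabel f G) (f e) h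
  | Gen.merge X Y e => Gen.merge (relabel f X) (relabel f Y) (f e)

/-- relabelling a bare birth [folklore] -/
@[simp] theorem relabel_born (f : ε → δ) (b : ε) (j : ℕ) : relabel f (Gen.born b j) = Gen.born (f b) j := rfl
/-- relabelling a renewal [folklore] -/
@[simp] theorem relabel_renew (f : ε → δ) (G : Gen ε) (e : ε) (h : ℕ) :
    relabel f (Gen.renew G e h) = Gen.renew (relabel f G) (f e) h := rfl
/-- relabelling a merger [folklore] -/
@[simp] theorem relabel_merge (f : ε → δ) (X Y : Gen ε) (e : ε) :
    relabel f (Gen.merge X Y e) = Gen.merge (relabel f X) (relabel f Y) (f e) := rfl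

/-- relabelling keeps the root step [folklore] -/
@[simp] theorem rootStep_relabel (f : ε → δ) : ∀ G : Gen ε, (relabel f G).rootStep = G.rootStep
  | Gen.born b j => rfl
  | Gen.renew G e h => by simp [rootStep_relabel f G]
  | Gen.merge X Y e => by simp [rootStep_relabel f X, rootStep_relabel f Y]

/-- relabelling maps the root [folklore] -/
@[simp] theorem root_relabel (f : ε → δ) : ∀ G : Gen ε, (relabel f G).root = f G.root
  | Gen.born b j => rfl
  | Gen.renew G e h => by simp [root_relabel f G]
  | Gen.merge X Y e => by
      simp only [relabel_merge, root_merge, rootStep_relabel, root_relabel f X, root_relabel f Y]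
      split_ifs <;> rfl

/-- relabelling along a window-preserving map keeps the reach [folklore] -/
theorem reach_relabel (f : ε → δ) {W : ε → ℕ} {W' : δ → ℕ} (hW : ∀ e, W' (f e) = W e) :
    ∀ G : Gen ε, (relabel f G).reach W' = G.reach W
  | Gen.born b j => by simp [hW]
  | Gen.renew G e h => by simp [hW]
  | Gen.merge X Y e => by simp [hW, reach_relabel f hW X, reach_relabel f hW Y]

/-- relabelling along a step-preserving map keeps the partner ages [folklore] -/
theorem partnerAges_relabel (f : ε → δ) {st : ε → ℕ} {st' : δ → ℕ} (hst : ∀ e, st' (f e) = st e) :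
    ∀ G : Gen ε, partnerAges st' (relabel f G) = partnerAges st G
  | Gen.born b j => by simp
  | Gen.renew G e h => by simp [partnerAges_relabel f hst G]
  | Gen.merge X Y e => by simp [partnerAges_relabel f hst X, partnerAges_relabel f hst Y, hst]

/-- relabelling pulls the full node product back [folklore] -/
theorem npAll_relabel (f : ε → δ) (η : δ → ℝ) : ∀ G : Gen ε, npAll η (relabel f G) = npAll (fun e => η (f e)) G
  | Gen.born b j => rfl
  | Gen.renew G e h => by simp [npAll_relabel f η G]
  | Gen.merge X Y e => by simp [npAll_relabel f η X, npAll_relabel f η Y]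

/-- relabelling pulls the non-root node product back [folklore] -/
theorem npNR_relabel (f : ε → δ) (η : δ → ℝ) : ∀ G : Gen ε, npNR η (relabel f G) = npNR (fun e => η (f e)) G
  | Gen.born b j => rfl
  | Gen.renew G e h => by simp [npNR_relabel f η G]
  | Gen.merge X Y e => by
      simp only [relabel_merge, npNR_merge, rootStep_relabel, npNR_relabel f η X, npNR_relabel f η Y,
        npAll_relabel f η X, npAll_relabel f η Y]

/-- **THE TREE WEIGHT IS A PULL-BACK**: along a step-preserving map, `treeWt ρ η θ st' (relabel f G) =
treeWt (ρ ∘ f) (η ∘ f) θ st G`. [folklore] -/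
theorem treeWt_relabel (f : ε → δ) (ρ η : δ → ℝ) (θ : ℝ) {st : ε → ℕ} {st' : δ → ℕ} (hst : ∀ e, st' (f e) = st e)
    (G : Gen ε) : treeWt ρ η θ st' (relabel f G) = treeWt (fun e => ρ (f e)) (fun e => η (f e)) θ st G := by
  simp only [treeWt, root_relabel, partnerAges_relabel f hst, npNR_relabel]

end Trees

/-! ## §2 The finite families of branching records (time-ordered genealogy terms of bounded fuel) -/

section Family

variable {δ : Type*} [DecidableEq δ]

/-- **THE BRANCHING RECORDS** of fuel `≤ n`, MAIN LINE born at step `s` with birth label in the menu `Lb`, all events at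
steps `≤ K`, built TIME-ORDERED from the menus: a renewal at step `t ∈ (s, K]` (label `e ∈ Lren t`, readiness `t − 1`) on
top of a record with events `≤ t`; a merger at step `t ∈ (s, K]` (label `e ∈ Lmer t`) of a main-line record with events
`≤ t` (OLDER line first) with a PARTNER record born at `s′ ∈ [s, t]` from the partner menu `Lpart s′`, events `≤ t`.
Parallel branches are separate subterms: NO distinctness of labels is asked, every tree shape is its own term. [folklore] -/
def fam (Lren Lmer Lpart : ℕ → Finset δ) : ℕ → Finset δ → ℕ → ℕ → Finset (Gen δ)
  | 0, _, _, _ => ∅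
  | n + 1, Lb, s, K =>
      Lb.image (fun b => Gen.born b s) ∪
      ((Ioc s K).biUnion fun t => (Lren t).biUnion fun e =>
        (fam Lren Lmer Lpart n Lb s t).image fun G => Gen.renew G e (t - 1)) ∪
      ((Ioc s K).biUnion fun t => (Lmer t).biUnion fun e => (Icc s t).biUnion fun s' =>
        (fam Lren Lmer Lpart n Lb s t ×ˢ fam Lren Lmer Lpart n (Lpart s') s' t).image fun p => Gen.merge p.1 p.2 e)

variable (Lren Lmer Lpart : ℕ → Finset δ)

/-- no record of fuel `0` [folklore] -/
@[simp] theorem fam_zero (Lb : Finset δ) (s K : ℕ) : fam Lren Lmer Lpart 0 Lb s K = ∅ := rfl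

/-- the records of fuel `≤ n + 1` (equation) [folklore] -/
theorem fam_succ (n : ℕ) (Lb : Finset δ) (s K : ℕ) : fam Lren Lmer Lpart (n + 1) Lb s K =
    Lb.image (fun b => Gen.born b s) ∪
      ((Ioc s K).biUnion fun t => (Lren t).biUnion fun e =>
        (fam Lren Lmer Lpart n Lb s t).image fun G => Gen.renew G e (t - 1)) ∪
      ((Ioc s K).biUnion fun t => (Lmer t).biUnion fun e => (Icc s t).biUnion fun s' =>
        (fam Lren Lmer Lpart n Lb s t ×ˢ fam Lren Lmer Lpart n (Lpart s') s' t).image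
          fun p => Gen.merge p.1 p.2 e) := rfl

variable {Lren Lmer Lpart}

/-- a bare birth from the menu is a record (of any positive fuel) [folklore] -/
theorem born_mem_fam {n : ℕ} {Lb : Finset δ} {s K : ℕ} {b : δ} (hb : b ∈ Lb) :
    Gen.born b s ∈ fam Lren Lmer Lpart (n + 1) Lb s K := by
  rw [fam_succ, mem_union, mem_union, mem_image]
  exact Or.inl (Or.inl ⟨b, hb, rfl⟩)

/-- a renewal at step `t ∈ (s, K]` from the menu on top of a record with events `≤ t` is a record [folklore] -/
theorem renew_mem_fam {n : ℕ} {Lb : Finset δ} {s K t : ℕ} (ht : t ∈ Ioc s K) {e : δ} (he : e ∈ Lren t) {G : Gen δ}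
    (hG : G ∈ fam Lren Lmer Lpart n Lb s t) : Gen.renew G e (t - 1) ∈ fam Lren Lmer Lpart (n + 1) Lb s K := by
  rw [fam_succ, mem_union, mem_union]
  refine Or.inl (Or.inr ?_)
  simp only [mem_biUnion, mem_image]
  exact ⟨t, ht, e, he, G, hG, rfl⟩

/-- a merger at step `t ∈ (s, K]` from the menu, older line first, with a partner born at `s′ ∈ [s, t]` from the partner
menu, both with events `≤ t`, is a record [folklore] -/
theorem merge_mem_fam {n : ℕ} {Lb : Finset δ} {s K t : ℕ} (ht : t ∈ Ioc s K) {e : δ} (he : e ∈ Lmer t) {s' : ℕ}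
    (hs' : s' ∈ Icc s t) {X Y : Gen δ} (hX : X ∈ fam Lren Lmer Lpart n Lb s t)
    (hY : Y ∈ fam Lren Lmer Lpart n (Lpart s') s' t) : Gen.merge X Y e ∈ fam Lren Lmer Lpart (n + 1) Lb s K := by
  rw [fam_succ, mem_union]
  refine Or.inr ?_
  simp only [mem_biUnion, mem_image, mem_product, Prod.exists]
  exact ⟨t, ht, e, he, s', hs', X, Y, ⟨hX, hY⟩, rfl⟩

/-- **CASE ANALYSIS of a record of fuel `≤ n + 1`** by its last event. [folklore] -/
theorem fam_cases {P : Gen δ → Prop} {n : ℕ} {Lb : Finset δ} {s K : ℕ} (hb : ∀ b ∈ Lb, P (Gen.born b s))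
    (hr : ∀ t ∈ Ioc s K, ∀ e ∈ Lren t, ∀ G ∈ fam Lren Lmer Lpart n Lb s t, P (Gen.renew G e (t - 1)))
    (hm : ∀ t ∈ Ioc s K, ∀ e ∈ Lmer t, ∀ s' ∈ Icc s t, ∀ X ∈ fam Lren Lmer Lpart n Lb s t,
      ∀ Y ∈ fam Lren Lmer Lpart n (Lpart s') s' t, P (Gen.merge X Y e)) :
    ∀ G ∈ fam Lren Lmer Lpart (n + 1) Lb s K, P G := by
  intro G hG
  rw [fam_succ, mem_union, mem_union] at hG
  rcases hG with (h | h) | h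
  · obtain ⟨b, hb', rfl⟩ := mem_image.1 h
    exact hb b hb'
  · simp only [mem_biUnion, mem_image] at h
    obtain ⟨t, ht, e, he, G', hG', rfl⟩ := h
    exact hr t ht e he G' hG'
  · simp only [mem_biUnion, mem_image, mem_product, Prod.exists] at h
    obtain ⟨t, ht, e, he, s', hs', X, Y, ⟨hX, hY⟩, rfl⟩ := h
    exact hm t ht e he s' hs' X hX Y hY

/-- **A RECORD IS BORN AT ITS MAIN-LINE STEP**: `rootStep G = s` on `fam n Lb s K`. [folklore] -/
theorem rootStep_of_mem_fam : ∀ (n : ℕ) (Lb : Finset δ) (s K : ℕ), ∀ G ∈ fam Lren Lmer Lpart n Lb s K, G.rootStep = s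
  | 0, Lb, s, K => by simp
  | n + 1, Lb, s, K =>
      fam_cases (fun b _ => rfl) (fun t _ e _ G hG => by simpa using rootStep_of_mem_fam n Lb s t G hG)
        (fun t _ e _ s' hs' X hX Y hY => by
          rw [Gen.rootStep_merge, rootStep_of_mem_fam n Lb s t X hX, rootStep_of_mem_fam n (Lpart s') s' t Y hY]
          exact min_eq_left (mem_Icc.1 hs').1)

/-- **THE ROOT OF A RECORD IS ITS MAIN-LINE BIRTH**: `root G ∈ Lb` on `fam n Lb s K`. [folklore] -/
theorem root_mem_of_mem_fam : ∀ (n : ℕ) (Lb : Finset δ) (s K : ℕ), ∀ G ∈ fam Lren Lmer Lpart n Lb s K, G.root ∈ Lb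
  | 0, Lb, s, K => by simp
  | n + 1, Lb, s, K =>
      fam_cases (fun b hb => by simpa using hb) (fun t _ e _ G hG => by simpa using root_mem_of_mem_fam n Lb s t G hG)
        (fun t _ e _ s' hs' X hX Y hY => by
          have h : X.rootStep ≤ Y.rootStep := by
            rw [rootStep_of_mem_fam n Lb s t X hX, rootStep_of_mem_fam n (Lpart s') s' t Y hY]
            exact (mem_Icc.1 hs').1
          rw [root_merge, if_pos h]
          exact root_mem_of_mem_fam n Lb s t X hX)

/-- the families grow with the fuel (one step) [folklore] -/
theorem fam_subset_succ : ∀ (n : ℕ) (Lb : Finset δ) (s K : ℕ),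
    fam Lren Lmer Lpart n Lb s K ⊆ fam Lren Lmer Lpart (n + 1) Lb s K
  | 0, Lb, s, K => by simp
  | n + 1, Lb, s, K => fun G hG =>
      fam_cases (P := fun G => G ∈ fam Lren Lmer Lpart (n + 2) Lb s K) (fun b hb => born_mem_fam hb)
        (fun t ht e he G hG => renew_mem_fam ht he (fam_subset_succ n Lb s t hG))
        (fun t ht e he s' hs' X hX Y hY =>
          merge_mem_fam ht he hs' (fam_subset_succ n Lb s t hX) (fam_subset_succ n (Lpart s') s' t hY)) G hG

/-- **THE FAMILIES GROW WITH THE FUEL**. [folklore] -/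
theorem fam_mono {n m : ℕ} (h : n ≤ m) (Lb : Finset δ) (s K : ℕ) :
    fam Lren Lmer Lpart n Lb s K ⊆ fam Lren Lmer Lpart m Lb s K := by
  induction h with
  | refl => exact subset_rfl
  | step _ ih => exact ih.trans (fam_subset_succ _ Lb s K)

/-- **… AND WITH THE CUTOFF**: a record with events `≤ K` is a record with events `≤ K′` for `K ≤ K′`. [folklore] -/
theorem fam_mono_right {n : ℕ} (Lb : Finset δ) (s : ℕ) {K K' : ℕ} (h : K ≤ K') :
    fam Lren Lmer Lpart n Lb s K ⊆ fam Lren Lmer Lpart n Lb s K' := by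
  cases n with
  | zero => simp
  | succ n =>
      intro G hG
      have hI : ∀ t ∈ Ioc s K, t ∈ Ioc s K' := fun t ht => by
        rw [mem_Ioc] at ht ⊢; exact ⟨ht.1, ht.2.trans h⟩
      exact fam_cases (P := fun G => G ∈ fam Lren Lmer Lpart (n + 1) Lb s K') (fun b hb => born_mem_fam hb)
        (fun t ht e he G hG => renew_mem_fam (hI t ht) he hG)
        (fun t ht e he s' hs' X hX Y hY => merge_mem_fam (hI t ht) he hs' hX hY) G hG

end Family

/-! ## §3 The branching records count -/

section Count

/-- a union sums to at most the sum of the parts, for nonnegative summands [folklore] -/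
theorem sum_union_le {ι : Type*} [DecidableEq ι] {s t : Finset ι} {f : ι → ℝ} (hf : ∀ x, 0 ≤ f x) :
    ∑ x ∈ s ∪ t, f x ≤ ∑ x ∈ s, f x + ∑ x ∈ t, f x := by
  rw [← Finset.sum_union_inter]
  exact le_add_of_nonneg_right (Finset.sum_nonneg fun x _ => hf x)

/-- an indexed union sums to at most the sum over the index of the sums of the parts, for nonnegative summands [folklore] -/
theorem sum_biUnion_le {ι κ : Type*} [DecidableEq ι] [DecidableEq κ] (s : Finset κ) (g : κ → Finset ι) {f : ι → ℝ}
    (hf : ∀ x, 0 ≤ f x) : ∑ x ∈ s.biUnion g, f x ≤ ∑ i ∈ s, ∑ x ∈ g i, f x := by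
  refine Finset.induction_on s (by simp) ?_
  intro a s ha ih
  rw [Finset.biUnion_insert, Finset.sum_insert ha]
  exact (sum_union_le hf).trans (by linarith [ih])

/-- **THE FIXED-POINT STEP**: `1 + x·Σ_{i < m} φ^{i+1} ≤ φ^m` for `1 ≤ φ`, `0 ≤ x`, `x·φ ≤ φ − 1` — the per-step factor
`φ` absorbs one more event of budget `x` at every later step (`x = 1 − 1/φ` is equality: `φ = 1/(1 − x)`). [folklore] -/
theorem one_add_mul_geom_le {x φ : ℝ} (hφ : 1 ≤ φ) (hx : 0 ≤ x) (hxφ : x * φ ≤ φ - 1) :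
    ∀ m : ℕ, 1 + x * ∑ i ∈ range m, φ ^ (i + 1) ≤ φ ^ m
  | 0 => by simp
  | m + 1 => by
      have ih := one_add_mul_geom_le hφ hx hxφ m
      have hφm : 0 ≤ φ ^ m := pow_nonneg (by linarith) m
      have hstep : φ ^ m * (x * φ) ≤ φ ^ m * (φ - 1) := mul_le_mul_of_nonneg_left hxφ hφm
      rw [Finset.sum_range_succ, mul_add, ← add_assoc, pow_succ]
      nlinarith [ih, hstep]

/-- the steps `(s, K]` re-indexed by `t − s − 1 < K − s` [folklore] -/
theorem sum_Ioc_pow_sub (φ : ℝ) (s K : ℕ) : ∑ t ∈ Ioc s K, φ ^ (t - s) = ∑ i ∈ range (K - s), φ ^ (i + 1) := by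
  have h : Ioc s K = Ico (s + 1) (K + 1) := by
    ext t; simp only [mem_Ioc, mem_Ico]; omega
  rw [h, Finset.sum_Ico_eq_sum_range]
  have hK : K + 1 - (s + 1) = K - s := by omega
  rw [hK]
  exact Finset.sum_congr rfl fun i _ => by congr 1; omega

variable {δ : Type*} [DecidableEq δ]

/-- **THE BRANCHING RECORDS COUNT.**  Menus with budgets — renewal labels `Σ_{Lren t} η ≤ a` per step, merger labels
`Σ_{Lmer t} η ≤ μ` per step (each merger label of step `t` has `st e = t`), partner births `Σ_{Lpart s′} η ≤ ν` per step —
an age factor `θ ≥ 0`, a per-step factor `φ ≥ 1` with the AGE SERIES `Σ_{s′ ∈ [s, t]} θ^{t+1−s′}·φ^{t−s′} ≤ Γ` and the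
FIXED-POINT SIDE CONDITION `(a + μ·ν·Γ)·φ ≤ φ − 1`, root residuals `ρ ≥ 0`, `η ≥ 0` ⇒ for every fuel `n`, root menu
`Lb`, birth step `s` and cutoff `K`:
`Σ_{G ∈ fam n Lb s K} ρ (root G)·θ^{partnerAges st G}·npNR η G ≤ (Σ_{b ∈ Lb} ρ b)·φ^{K − s}`.
By induction on the fuel (a branching generating function is the least fixed point of its step map; the bound is a
pre-fixed point): a renewal at step `t` costs `a`, a merger at step `t` costs `μ` times the partner's own count
`ν·φ^{t−s′}` times its age factor `θ^{t+1−s′}`, summed over the partner's birth step — `≤ μνΓ`; the main line up to `t`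
is counted by `φ^{t−s}` (induction), and `1 + (a + μνΓ)·Σ_{t ∈ (s,K]} φ^{t−s} ≤ φ^{K−s}` is `one_add_mul_geom_le`.
UNIFORM IN THE FUEL; parallel branches, simultaneous same-class events and tree shapes are all summed. [folklore] -/
theorem famSum_le (Lren Lmer Lpart : ℕ → Finset δ) (st : δ → ℕ) (hst : ∀ t, ∀ e ∈ Lmer t, st e = t)
    (η : δ → ℝ) (hη : ∀ e, 0 ≤ η e) {a μ ν θ φ Γ : ℝ} (hθ : 0 ≤ θ) (hφ : 1 ≤ φ)
    (ha : ∀ t, ∑ e ∈ Lren t, η e ≤ a) (hμ : ∀ t, ∑ e ∈ Lmer t, η e ≤ μ) (hν : ∀ s, ∑ b ∈ Lpart s, η b ≤ ν)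
    (hΓ : ∀ s t, ∑ s' ∈ Icc s t, θ ^ (t + 1 - s') * φ ^ (t - s') ≤ Γ) (hx : (a + μ * ν * Γ) * φ ≤ φ - 1)
    (n : ℕ) (ρ : δ → ℝ) (hρ : ∀ b, 0 ≤ ρ b) (Lb : Finset δ) (s K : ℕ) :
    ∑ G ∈ fam Lren Lmer Lpart n Lb s K, treeWt ρ η θ st G ≤ (∑ b ∈ Lb, ρ b) * φ ^ (K - s) := by
  have ha0 : 0 ≤ a := (Finset.sum_nonneg fun e _ => hη e).trans (ha 0)
  have hμ0 : 0 ≤ μ := (Finset.sum_nonneg fun e _ => hη e).trans (hμ 0)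
  have hν0 : 0 ≤ ν := (Finset.sum_nonneg fun e _ => hη e).trans (hν 0)
  have hΓ0 : 0 ≤ Γ := (Finset.sum_nonneg fun s' _ => mul_nonneg (pow_nonneg hθ _) (pow_nonneg (zero_le_one.trans hφ) _))
    |>.trans (hΓ 0 0)
  have hφ0 : 0 ≤ φ := zero_le_one.trans hφ
  induction n generalizing ρ Lb s K with
  | zero =>
      simp only [fam_zero, Finset.sum_empty]
      exact mul_nonneg (Finset.sum_nonneg fun b _ => hρ b) (pow_nonneg hφ0 _)
  | succ n ih =>
      -- notation
      set B := ∑ b ∈ Lb, ρ b with hB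
      have hB0 : 0 ≤ B := Finset.sum_nonneg fun b _ => hρ b
      have hw0 : ∀ G, 0 ≤ treeWt ρ η θ st G := treeWt_nonneg hρ hη hθ st
      have hw0' : ∀ G, 0 ≤ treeWt η η θ st G := treeWt_nonneg hη hη hθ st
      -- the three parts
      have hA : ∑ G ∈ Lb.image (fun b => Gen.born b s), treeWt ρ η θ st G = B := by
        rw [Finset.sum_image fun b _ b' _ h => by simpa using h]
        simp [hB]
      have hR : ∀ t ∈ Ioc s K, ∑ G ∈ (Lren t).biUnion (fun e =>
          (fam Lren Lmer Lpart n Lb s t).image fun G => Gen.renew G e (t - 1)), treeWt ρ η θ st G ≤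
            B * φ ^ (t - s) * a := by
        intro t ht
        refine (sum_biUnion_le _ _ hw0).trans ?_
        have hin : ∀ e ∈ Lren t, ∑ G ∈ (fam Lren Lmer Lpart n Lb s t).image (fun G => Gen.renew G e (t - 1)),
            treeWt ρ η θ st G = (∑ G ∈ fam Lren Lmer Lpart n Lb s t, treeWt ρ η θ st G) * η e := by
          intro e _
          rw [Finset.sum_image fun G _ G' _ h => by simpa using h]
          simp only [treeWt_renew, Finset.sum_mul]
        rw [Finset.sum_congr rfl hin, ← Finset.mul_sum]
        exact mul_le_mul (ih ρ hρ Lb s t) (ha t) (Finset.sum_nonneg fun e _ => hη e)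
          (mul_nonneg hB0 (pow_nonneg hφ0 _))
      have hM : ∀ t ∈ Ioc s K, ∑ G ∈ (Lmer t).biUnion (fun e => (Icc s t).biUnion fun s' =>
          (fam Lren Lmer Lpart n Lb s t ×ˢ fam Lren Lmer Lpart n (Lpart s') s' t).image
            fun p => Gen.merge p.1 p.2 e), treeWt ρ η θ st G ≤ B * φ ^ (t - s) * (μ * ν * Γ) := by
        intro t ht
        refine (sum_biUnion_le _ _ hw0).trans ?_
        -- per merger label
        have hin : ∀ e ∈ Lmer t, ∑ G ∈ (Icc s t).biUnion (fun s' =>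
            (fam Lren Lmer Lpart n Lb s t ×ˢ fam Lren Lmer Lpart n (Lpart s') s' t).image
              fun p => Gen.merge p.1 p.2 e), treeWt ρ η θ st G ≤ B * φ ^ (t - s) * (ν * Γ) * η e := by
          intro e he
          refine (sum_biUnion_le _ _ hw0).trans ?_
          -- per partner birth step
          have hin' : ∀ s' ∈ Icc s t,
              ∑ G ∈ (fam Lren Lmer Lpart n Lb s t ×ˢ fam Lren Lmer Lpart n (Lpart s') s' t).image
                (fun p => Gen.merge p.1 p.2 e), treeWt ρ η θ st G ≤
                B * φ ^ (t - s) * (θ ^ (t + 1 - s') * (ν * φ ^ (t - s')) * η e) := by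
            intro s' hs'
            rw [Finset.sum_image fun p _ p' _ h => by
              obtain ⟨h1, h2, -⟩ := Gen.merge.inj h; exact Prod.ext h1 h2]
            rw [Finset.sum_product]
            have hXY : ∀ X ∈ fam Lren Lmer Lpart n Lb s t, ∀ Y ∈ fam Lren Lmer Lpart n (Lpart s') s' t,
                treeWt ρ η θ st (Gen.merge X Y e) =
                  treeWt ρ η θ st X * (θ ^ (t + 1 - s') * treeWt η η θ st Y * η e) := by
              intro X hX Y hY
              have hrX := rootStep_of_mem_fam n Lb s t X hX
              have hrY := rootStep_of_mem_fam n (Lpart s') s' t Y hY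
              have hle : X.rootStep ≤ Y.rootStep := by rw [hrX, hrY]; exact (mem_Icc.1 hs').1
              rw [treeWt_merge_of_le ρ η θ st hle e, hst t e he, hrY]
            rw [Finset.sum_congr rfl fun X hX => Finset.sum_congr rfl fun Y hY => hXY X hX Y hY]
            simp_rw [← Finset.mul_sum]
            rw [← Finset.sum_mul]
            have hYsum : ∑ Y ∈ fam Lren Lmer Lpart n (Lpart s') s' t, θ ^ (t + 1 - s') * treeWt η η θ st Y * η e =
                θ ^ (t + 1 - s') * (∑ Y ∈ fam Lren Lmer Lpart n (Lpart s') s' t, treeWt η η θ st Y) * η e := by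
              rw [Finset.mul_sum, Finset.sum_mul]
            rw [hYsum]
            have hYle : ∑ Y ∈ fam Lren Lmer Lpart n (Lpart s') s' t, treeWt η η θ st Y ≤ ν * φ ^ (t - s') :=
              (ih η hη (Lpart s') s' t).trans (mul_le_mul_of_nonneg_right (hν s') (pow_nonneg hφ0 _))
            refine mul_le_mul (ih ρ hρ Lb s t) ?_ ?_ (mul_nonneg hB0 (pow_nonneg hφ0 _))
            · exact mul_le_mul_of_nonneg_right (mul_le_mul_of_nonneg_left hYle (pow_nonneg hθ _)) (hη e)
            · exact mul_nonneg (mul_nonneg (pow_nonneg hθ _) (Finset.sum_nonneg fun Y _ => hw0' Y)) (hη e)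
          refine (Finset.sum_le_sum hin').trans ?_
          have hre : ∑ s' ∈ Icc s t, B * φ ^ (t - s) * (θ ^ (t + 1 - s') * (ν * φ ^ (t - s')) * η e) =
              B * φ ^ (t - s) * ν * η e * ∑ s' ∈ Icc s t, θ ^ (t + 1 - s') * φ ^ (t - s') := by
            rw [Finset.mul_sum]
            exact Finset.sum_congr rfl fun s' _ => by ring
          rw [hre]
          calc B * φ ^ (t - s) * ν * η e * ∑ s' ∈ Icc s t, θ ^ (t + 1 - s') * φ ^ (t - s')
              ≤ B * φ ^ (t - s) * ν * η e * Γ :=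
                mul_le_mul_of_nonneg_left (hΓ s t)
                  (mul_nonneg (mul_nonneg (mul_nonneg hB0 (pow_nonneg hφ0 _)) hν0) (hη e))
            _ = B * φ ^ (t - s) * (ν * Γ) * η e := by ring
        refine (Finset.sum_le_sum hin).trans ?_
        rw [← Finset.mul_sum]
        calc B * φ ^ (t - s) * (ν * Γ) * ∑ e ∈ Lmer t, η e ≤ B * φ ^ (t - s) * (ν * Γ) * μ :=
              mul_le_mul_of_nonneg_left (hμ t)
                (mul_nonneg (mul_nonneg hB0 (pow_nonneg hφ0 _)) (mul_nonneg hν0 hΓ0))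
          _ = B * φ ^ (t - s) * (μ * ν * Γ) := by ring
      -- assemble
      rw [fam_succ]
      refine ((sum_union_le hw0).trans (add_le_add (sum_union_le hw0) le_rfl)).trans ?_
      rw [hA]
      refine (add_le_add (add_le_add le_rfl ((sum_biUnion_le _ _ hw0).trans (Finset.sum_le_sum hR)))
        ((sum_biUnion_le _ _ hw0).trans (Finset.sum_le_sum hM))).trans ?_
      have hsplit : B + ∑ t ∈ Ioc s K, B * φ ^ (t - s) * a + ∑ t ∈ Ioc s K, B * φ ^ (t - s) * (μ * ν * Γ) =
          B * (1 + (a + μ * ν * Γ) * ∑ i ∈ range (K - s), φ ^ (i + 1)) := by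
        rw [← sum_Ioc_pow_sub, Finset.mul_sum, add_assoc, ← Finset.sum_add_distrib, mul_add, mul_one, Finset.mul_sum]
        congr 1
        exact Finset.sum_congr rfl fun t _ => by ring
      rw [hsplit]
      exact mul_le_mul_of_nonneg_left
        (one_add_mul_geom_le hφ (add_nonneg ha0 (mul_nonneg (mul_nonneg hμ0 hν0) hΓ0)) hx (K - s)) hB0

end Count

/-! ## §4 The age series in closed form; the count at the two rates of the records gas -/

section Rates

variable {δ : Type*} [DecidableEq δ]

/-- **THE AGE SERIES**: `Σ_{s′ ∈ [s, t]} θ^{t+1−s′}·φ^{t−s′} ≤ θ/(1 − θφ)` for `0 ≤ θ`, `0 ≤ φ`, `θφ < 1` — a partner of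
age `a` costs `θ^{a+1}·φ^{a}`: its position multiplicity and its own per-step entropy against the surplus window credit of
its pendency (`T4LiveStructureGas.sum_range_succ_pow_sub_le` by name).  UNIFORM in `s`, `t`. [folklore] -/
theorem ageSeries_le {θ φ : ℝ} (hθ : 0 ≤ θ) (hφ : 0 ≤ φ) (h1 : θ * φ < 1) (s t : ℕ) :
    ∑ s' ∈ Icc s t, θ ^ (t + 1 - s') * φ ^ (t - s') ≤ θ / (1 - θ * φ) := by
  have hre : ∀ s' ∈ Icc s t, θ ^ (t + 1 - s') * φ ^ (t - s') = θ * (θ * φ) ^ (t - s') := by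
    intro s' hs'
    have h : t + 1 - s' = (t - s') + 1 := by have := (mem_Icc.1 hs').2; omega
    rw [h, pow_succ, mul_pow]; ring
  rw [Finset.sum_congr rfl hre, ← Finset.mul_sum]
  have hsub : ∑ s' ∈ Icc s t, (θ * φ) ^ (t - s') ≤ ∑ s' ∈ range (t + 1), (θ * φ) ^ (t - s') :=
    Finset.sum_le_sum_of_subset_of_nonneg (fun s' hs' => by
      rw [mem_Icc] at hs'; exact mem_range.2 (Nat.lt_succ_of_le hs'.2))
      (fun _ _ _ => pow_nonneg (mul_nonneg hθ hφ) _)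
  calc θ * ∑ s' ∈ Icc s t, (θ * φ) ^ (t - s') ≤ θ * (1 / (1 - θ * φ)) :=
        mul_le_mul_of_nonneg_left (hsub.trans (sum_range_succ_pow_sub_le (mul_nonneg hθ hφ) h1 t)) hθ
    _ = θ / (1 - θ * φ) := by rw [mul_one_div]

/-- **THE COUNT AT THE RECORDS GAS'S RATES.**  With the per-step factor `φ = e^{η̄₊}` (`0 ≤ η̄₊`), an age factor `θ ≥ 0`
with `θ·e^{η̄₊} < 1`, and the fixed-point side condition `(a + μν·θ/(1 − θe^{η̄₊}))·e^{η̄₊} ≤ e^{η̄₊} − 1`: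
`Σ_{G ∈ fam n Lb s K} treeWt ρ η θ st G ≤ (Σ_{Lb} ρ)·(e^{η̄₊})^{K − s}` — `famSum_le` with `ageSeries_le`. [folklore] -/
theorem famSum_le_exp (Lren Lmer Lpart : ℕ → Finset δ) (st : δ → ℕ) (hst : ∀ t, ∀ e ∈ Lmer t, st e = t)
    (η : δ → ℝ) (hη : ∀ e, 0 ≤ η e) {a μ ν θ ηplus : ℝ} (hθ : 0 ≤ θ) (hηplus : 0 ≤ ηplus)
    (ha : ∀ t, ∑ e ∈ Lren t, η e ≤ a) (hμ : ∀ t, ∑ e ∈ Lmer t, η e ≤ μ) (hν : ∀ s, ∑ b ∈ Lpart s, η b ≤ ν)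
    (h1 : θ * Real.exp ηplus < 1)
    (hx : (a + μ * ν * (θ / (1 - θ * Real.exp ηplus))) * Real.exp ηplus ≤ Real.exp ηplus - 1)
    (n : ℕ) (ρ : δ → ℝ) (hρ : ∀ b, 0 ≤ ρ b) (Lb : Finset δ) (s K : ℕ) :
    ∑ G ∈ fam Lren Lmer Lpart n Lb s K, treeWt ρ η θ st G ≤ (∑ b ∈ Lb, ρ b) * Real.exp ηplus ^ (K - s) :=
  famSum_le Lren Lmer Lpart st hst η hη hθ (Real.one_le_exp hηplus) ha hμ hν
    (ageSeries_le hθ (Real.exp_pos _).le h1) hx n ρ hρ Lb s K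

/-- the two rates: `e^{−κ₁ (K + 1 − j)}·(e^{η̄₊})^{K − j} = e^{−κ₁}·(e^{η̄₊ − κ₁})^{K − j}` for `j ≤ K` [folklore] -/
theorem twoRate_eq {κ₁ ηplus : ℝ} {j K : ℕ} (hjK : j ≤ K) :
    Real.exp (-(κ₁ * ((K + 1 - j : ℕ) : ℝ))) * Real.exp ηplus ^ (K - j) =
      Real.exp (-κ₁) * Real.exp (ηplus - κ₁) ^ (K - j) := by
  have h : ((K + 1 - j : ℕ) : ℝ) = ((K - j : ℕ) : ℝ) + 1 := by
    rw [show K + 1 - j = (K - j) + 1 by omega]; push_cast; ring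
  rw [h, show -(κ₁ * (((K - j : ℕ) : ℝ) + 1)) = -κ₁ + ((K - j : ℕ) : ℝ) * (-κ₁) by ring, Real.exp_add,
    Real.exp_nat_mul, mul_assoc, ← mul_pow, ← Real.exp_add, show -κ₁ + ηplus = ηplus - κ₁ by ring]

/-- **THE PER-SLOT TWO-RATE BOUND FROM TELESCOPED TREE PRICES**: prices `y G ≤ e^{−κ₁ (K + 1 − j)}·treeWt ρ η θ st G` on
the records `fam n Lb j K` with `Σ_{Lb} ρ ≤ ρ̄` ⇒ `Σ_G y G ≤ ρ̄·e^{−κ₁}·(e^{η̄₊ − κ₁})^{K − j}` — EXACTLY the per-slot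
shape of `T4PersistentHistoryCount.slotPrice_le` / `T4PartnerMultiplicity.slotPriceT_le`, with `η̄₊` for `η̄`. [folklore] -/
theorem bslotPriceT_le (Lren Lmer Lpart : ℕ → Finset δ) (st : δ → ℕ) (hst : ∀ t, ∀ e ∈ Lmer t, st e = t)
    (η : δ → ℝ) (hη : ∀ e, 0 ≤ η e) {a μ ν θ ηplus : ℝ} (hθ : 0 ≤ θ) (hηplus : 0 ≤ ηplus)
    (ha : ∀ t, ∑ e ∈ Lren t, η e ≤ a) (hμ : ∀ t, ∑ e ∈ Lmer t, η e ≤ μ) (hν : ∀ s, ∑ b ∈ Lpart s, η b ≤ ν)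
    (h1 : θ * Real.exp ηplus < 1)
    (hx : (a + μ * ν * (θ / (1 - θ * Real.exp ηplus))) * Real.exp ηplus ≤ Real.exp ηplus - 1)
    (n : ℕ) (ρ : δ → ℝ) (hρ : ∀ b, 0 ≤ ρ b) (Lb : Finset δ) {ρbar : ℝ} (hρbar : ∑ b ∈ Lb, ρ b ≤ ρbar) {κ₁ : ℝ}
    {j K : ℕ} (hjK : j ≤ K) (y : Gen δ → ℝ)
    (hy : ∀ G ∈ fam Lren Lmer Lpart n Lb j K, y G ≤ Real.exp (-(κ₁ * ((K + 1 - j : ℕ) : ℝ))) * treeWt ρ η θ st G) :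
    ∑ G ∈ fam Lren Lmer Lpart n Lb j K, y G ≤ ρbar * Real.exp (-κ₁) * Real.exp (ηplus - κ₁) ^ (K - j) := by
  refine (Finset.sum_le_sum hy).trans ?_
  rw [← Finset.mul_sum]
  calc Real.exp (-(κ₁ * ((K + 1 - j : ℕ) : ℝ))) * ∑ G ∈ fam Lren Lmer Lpart n Lb j K, treeWt ρ η θ st G
      ≤ Real.exp (-(κ₁ * ((K + 1 - j : ℕ) : ℝ))) * (ρbar * Real.exp ηplus ^ (K - j)) :=
        mul_le_mul_of_nonneg_left ((famSum_le_exp Lren Lmer Lpart st hst η hη hθ hηplus ha hμ hν h1 hx n ρ hρ Lb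
          j K).trans (mul_le_mul_of_nonneg_right hρbar (pow_nonneg (Real.exp_pos _).le _))) (Real.exp_pos _).le
    _ = ρbar * Real.exp (-κ₁) * Real.exp (ηplus - κ₁) ^ (K - j) := by
        rw [mul_left_comm, twoRate_eq hjK]; ring

end Rates

/-! ## §5 Branching live slots, their masses, and the composition BY NAME into the term-level weight slot -/

section Slots

variable {γ δ : Type*}

/-- **A BRANCHING LIVE SLOT**: birth step `j`, birth cell `z` of the root, and the branching record `G` (a genealogy
term over class labels) of the structure. [folklore] -/
abbrev BSlot (γ δ : Type*) : Type _ := Σ _ : ℕ, Σ _ : γ, Gen δ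

/-- **THE BRANCHING LIVE INDEX SET AT CUTOFF `K`**: births `j ≤ K`, cells `z ∈ Cell K (K − j)`, records `G ∈ F K j`.
[folklore] -/
def bliveSlots (Cell : ℕ → ℕ → Finset γ) (F : ℕ → ℕ → Finset (Gen δ)) (K : ℕ) : Finset (BSlot γ δ) :=
  (range (K + 1)).sigma fun j => (Cell K (K - j)).sigma fun _ => F K j

/-- **ITS OLD PART**: births `j < j⋆ K`. [folklore] -/
def boldSlots (Cell : ℕ → ℕ → Finset γ) (F : ℕ → ℕ → Finset (Gen δ)) (jstar : ℕ → ℕ) (K : ℕ) :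
    Finset (BSlot γ δ) :=
  (range (jstar K)).sigma fun j => (Cell K (K - j)).sigma fun _ => F K j

/-- old branching slots are live (`j⋆ K ≤ K`) [folklore] -/
theorem boldSlots_subset_bliveSlots (Cell : ℕ → ℕ → Finset γ) (F : ℕ → ℕ → Finset (Gen δ)) {jstar : ℕ → ℕ}
    {K : ℕ} (hj : jstar K ≤ K) : boldSlots Cell F jstar K ⊆ bliveSlots Cell F K := by
  intro s hs
  simp only [boldSlots, bliveSlots, Finset.mem_sigma, Finset.mem_range] at hs ⊢
  exact ⟨by omega, hs.2⟩

/-- sums over the branching live slots are iterated sums [folklore] -/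
theorem sum_bliveSlots_eq (Cell : ℕ → ℕ → Finset γ) (F : ℕ → ℕ → Finset (Gen δ)) (K : ℕ) (f : BSlot γ δ → ℝ) :
    ∑ s ∈ bliveSlots Cell F K, f s = ∑ j ∈ range (K + 1), ∑ z ∈ Cell K (K - j), ∑ G ∈ F K j, f ⟨j, z, G⟩ := by
  simp only [bliveSlots, Finset.sum_sigma]

/-- … and over the old ones [folklore] -/
theorem sum_boldSlots_eq (Cell : ℕ → ℕ → Finset γ) (F : ℕ → ℕ → Finset (Gen δ)) (jstar : ℕ → ℕ) (K : ℕ)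
    (f : BSlot γ δ → ℝ) :
    ∑ s ∈ boldSlots Cell F jstar K, f s = ∑ j ∈ range (jstar K), ∑ z ∈ Cell K (K - j), ∑ G ∈ F K j, f ⟨j, z, G⟩ := by
  simp only [boldSlots, Finset.sum_sigma]

/-- the price of a branching slot [folklore] -/
def bslotPrice (y : ℕ → γ → Gen δ → ℝ) (s : BSlot γ δ) : ℝ := y s.1 s.2.1 s.2.2

/-- the price of `⟨j, z, G⟩` is `y j z G` [folklore] -/
@[simp] theorem bslotPrice_mk (y : ℕ → γ → Gen δ → ℝ) (j : ℕ) (z : γ) (G : Gen δ) :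
    bslotPrice y ⟨j, z, G⟩ = y j z G := rfl

/-- **THE LIVE MASS FROM A PER-SLOT BOUND** (as `T4PartnerMultiplicity.liveMass_le_of_slotBound`, tree-indexed): cells
`#Cell K a ≤ V·Λ^a`, per-slot totals `Σ_{G ∈ F K j} y j z G ≤ C·σ^{K − j}`, `Λσ < 1` ⇒ live mass `≤ C·V/(1 − Λσ)`. [folklore] -/
theorem bliveMass_le_of_slotBound (Cell : ℕ → ℕ → Finset γ) {V Λ Cst σ : ℝ} (hV : 0 ≤ V) (hΛ : 0 ≤ Λ)
    (hCst : 0 ≤ Cst) (hσ : 0 ≤ σ) (hr : Λ * σ < 1) {K : ℕ} (hcell : ∀ a, ((Cell K a).card : ℝ) ≤ V * Λ ^ a)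
    (F : ℕ → ℕ → Finset (Gen δ)) (y : ℕ → γ → Gen δ → ℝ)
    (hX : ∀ j ≤ K, ∀ z ∈ Cell K (K - j), ∑ G ∈ F K j, y j z G ≤ Cst * σ ^ (K - j)) :
    ∑ s ∈ bliveSlots Cell F K, bslotPrice y s ≤ Cst * V * (1 / (1 - Λ * σ)) := by
  rw [sum_bliveSlots_eq]
  simp only [bslotPrice_mk]
  calc ∑ j ∈ range (K + 1), ∑ z ∈ Cell K (K - j), ∑ G ∈ F K j, y j z G
      ≤ ∑ j ∈ range (K + 1), ∑ _z ∈ Cell K (K - j), Cst * σ ^ (K - j) :=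
        Finset.sum_le_sum fun j hj => Finset.sum_le_sum fun z hz =>
          hX j (Nat.lt_succ_iff.1 (Finset.mem_range.1 hj)) z hz
    _ ≤ ∑ j ∈ range (K + 1), Cst * V * (Λ * σ) ^ (K - j) := by
        refine Finset.sum_le_sum fun j _ => ?_
        rw [Finset.sum_const, nsmul_eq_mul]
        calc ((Cell K (K - j)).card : ℝ) * (Cst * σ ^ (K - j))
            ≤ V * Λ ^ (K - j) * (Cst * σ ^ (K - j)) :=
              mul_le_mul_of_nonneg_right (hcell (K - j)) (mul_nonneg hCst (pow_nonneg hσ _))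
          _ = Cst * V * (Λ * σ) ^ (K - j) := by rw [mul_pow]; ring
    _ = Cst * V * ∑ j ∈ range (K + 1), (Λ * σ) ^ (K - j) := by rw [Finset.mul_sum]
    _ ≤ Cst * V * (1 / (1 - Λ * σ)) :=
        mul_le_mul_of_nonneg_left (sum_range_succ_pow_sub_le (mul_nonneg hΛ hσ) hr K) (mul_nonneg hCst hV)

/-- **THE OLD MASS FROM A PER-SLOT BOUND** (tree-indexed `oldMass_le_of_slotBound`): per-slot totals `≤ C·σ^{K − j}` for
`j < j⋆ K ≤ K` ⇒ old mass `≤ C·V·(Λσ)^{K − j⋆ K + 1}/(1 − Λσ)` (`T4PersistentHistoryCount.slotBudget_model`). [folklore] -/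
theorem boldMass_le_of_slotBound (Cell : ℕ → ℕ → Finset γ) {V Λ Cst σ : ℝ} (hV : 0 ≤ V) (hΛ : 0 ≤ Λ)
    (hCst : 0 ≤ Cst) (hσ : 0 ≤ σ) (hr : Λ * σ < 1) {K : ℕ} (hcell : ∀ a, ((Cell K a).card : ℝ) ≤ V * Λ ^ a)
    (F : ℕ → ℕ → Finset (Gen δ)) {jstar : ℕ → ℕ} (hj : jstar K ≤ K) (y : ℕ → γ → Gen δ → ℝ)
    (hX : ∀ j < jstar K, ∀ z ∈ Cell K (K - j), ∑ G ∈ F K j, y j z G ≤ Cst * σ ^ (K - j)) :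
    ∑ s ∈ boldSlots Cell F jstar K, bslotPrice y s ≤ Cst * V * ((Λ * σ) ^ (K - jstar K + 1) / (1 - Λ * σ)) := by
  rw [sum_boldSlots_eq]
  simp only [bslotPrice_mk]
  exact slotBudget_model (Cell K) hV hΛ hCst hσ hr hcell hj (fun j z => ∑ G ∈ F K j, y j z G) hX

end Slots

section Run

variable {γ δ κ ι : Type*} [DecidableEq γ] [DecidableEq δ] [DecidableEq κ] {l₀ : ℝ} {K₀ : ℕ} {π : ℕ → ι → κ}
  {T : ℕ → Finset ι} {A A' : ℕ → ℝ → ι → ℝ} {Bad' : ℕ → ℝ → Finset κ} {dead dead' : ℕ → ℝ → ι → ℝ}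
  {F Rf F' Rf' : ℕ → κ → ℝ} {nlow nup mlow mup : ℕ → ℝ → ℝ} {Cn : ℝ}

/-- **THE BRANCHING RECORDS OF THE RUN**: at cutoff `K`, birth step `j` — fuel `Ncap K`, root menu `Lroot K j`, the
run's renewal / merger / partner menus. [folklore] -/
def runFam (Lren Lmer Lpart : ℕ → ℕ → Finset δ) (Lroot : ℕ → ℕ → Finset δ) (Ncap : ℕ → ℕ) (K j : ℕ) :
    Finset (Gen δ) :=
  fam (Lren K) (Lmer K) (Lpart K) (Ncap K) (Lroot K j) j K

/-- **REGENERATION READING + BRANCHING RECORDS GAS ⇒ TERM-LEVEL SLOT.**  The renewal member's ABSTRACT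
`T4LiveGasToTerms.exists_relWeightBound_of_regeneration_liveGas` (abstract in the slot type) with `U K := bliveSlots
Cell (runFam …) K`, `O K := boldSlots Cell (runFam …) j⋆ K`, prices `bslotPrice (y K)`, and the masses of §5 fed by
`bslotPriceT_le`: per cutoff `K ≥ K₀`, prices in the TELESCOPED TREE SHAPE `y K j z G ≤ e^{−κ₁ (K + 1 − j)}·treeWt (ρ K)
(η K) θ st G` on the branching records, budgets `Σ_{Lroot K j} ρ K ≤ ρ̄`, `Σ_{Lren K t} η K ≤ a`, `Σ_{Lmer K t} η K ≤ μ`,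
`Σ_{Lpart K s} η K ≤ ν`, age factor `θ ≥ 0` with `θ·e^{η̄₊} < 1`, the fixed-point side condition, the ROOT RATE
`Λ·e^{η̄₊ − κ₁} < 1`, `c·K ≤ K − j⋆ K`, injective live families with an old slot, two term-level `Regeneration` runs
dominated by `famWeight (bslotPrice (y K))`, `0 ≤ C` ⇒ `∃ K₁ ≥ K₀`, the kernel's term-level `RelWeightBound` with
`W = 𝟙_{K ≥ K₁}·C·recordsBudget ρ̄ κ₁ V Λ η̄₊ j⋆` — the SAME budget shape as every earlier seam of this chain. [folklore] -/
theorem exists_relWeightBound_of_regeneration_branchingGasRun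
    (Cell : ℕ → ℕ → Finset γ) {V Λ : ℝ} (hV : 0 ≤ V) (hΛ : 0 < Λ)
    (hcell : ∀ K a, ((Cell K a).card : ℝ) ≤ V * Λ ^ a)
    (Lren Lmer Lpart : ℕ → ℕ → Finset δ) (Lroot : ℕ → ℕ → Finset δ) (Ncap : ℕ → ℕ) (st : δ → ℕ)
    (hst : ∀ K t, ∀ e ∈ Lmer K t, st e = t) {κ₁ ρbar a μ ν θ ηplus : ℝ} (ρ η : ℕ → δ → ℝ)
    (hρ : ∀ K b, 0 ≤ ρ K b) (hη : ∀ K e, 0 ≤ η K e) (hρbar : ∀ K j, ∑ b ∈ Lroot K j, ρ K b ≤ ρbar)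
    (ha : ∀ K t, ∑ e ∈ Lren K t, η K e ≤ a) (hμ : ∀ K t, ∑ e ∈ Lmer K t, η K e ≤ μ)
    (hν : ∀ K s, ∑ b ∈ Lpart K s, η K b ≤ ν) (hθ : 0 ≤ θ) (hηplus : 0 ≤ ηplus) (h1 : θ * Real.exp ηplus < 1)
    (hx : (a + μ * ν * (θ / (1 - θ * Real.exp ηplus))) * Real.exp ηplus ≤ Real.exp ηplus - 1)
    (hr : Λ * Real.exp (ηplus - κ₁) < 1) (jstar : ℕ → ℕ) (hj : ∀ K, jstar K ≤ K) {c : ℝ} (hc : 0 < c)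
    (hfrac : ∀ K : ℕ, c * K ≤ ((K - jstar K : ℕ) : ℝ)) (y : ℕ → ℕ → γ → Gen δ → ℝ)
    (hy0 : ∀ K, ∀ j ≤ K, ∀ z ∈ Cell K (K - j), ∀ G ∈ runFam Lren Lmer Lpart Lroot Ncap K j, 0 ≤ y K j z G)
    (hyT : ∀ K, K₀ ≤ K → ∀ j ≤ K, ∀ z ∈ Cell K (K - j), ∀ G ∈ runFam Lren Lmer Lpart Lroot Ncap K j,
      y K j z G ≤ Real.exp (-(κ₁ * ((K + 1 - j : ℕ) : ℝ))) * treeWt (ρ K) (η K) θ st G)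
    (str : ℕ → κ → Finset (BSlot γ δ))
    (hinj : ∀ K t, |t| ≤ l₀ → K₀ ≤ K → Set.InjOn (str K) (Bad' K t))
    (hstr : ∀ K t, |t| ≤ l₀ → K₀ ≤ K → ∀ c ∈ Bad' K t,
      str K c ⊆ bliveSlots Cell (runFam Lren Lmer Lpart Lroot Ncap) K ∧
        ∃ o ∈ boldSlots Cell (runFam Lren Lmer Lpart Lroot Ncap) jstar K, o ∈ str K c)
    (hA : Regeneration l₀ π T A Bad' dead F Rf nlow nup Cn K₀)
    (hA' : Regeneration l₀ π T A' Bad' dead' F' Rf' mlow mup Cn K₀)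
    (hF : ∀ K t, |t| ≤ l₀ → K₀ ≤ K → ∀ c ∈ Bad' K t, F K c * Rf K c ≤ famWeight (bslotPrice (y K)) (str K c))
    (hF' : ∀ K t, |t| ≤ l₀ → K₀ ≤ K → ∀ c ∈ Bad' K t, F' K c * Rf' K c ≤ famWeight (bslotPrice (y K)) (str K c))
    (hCn : 0 ≤ Cn) :
    ∃ K₁, K₀ ≤ K₁ ∧ RelWeightBound l₀ T A A' (fun K t => if K₁ ≤ K then badOfClass π T Bad' K t else ∅)
      (Set.indicator {K | K₁ ≤ K} (fun K => Cn * recordsBudget ρbar κ₁ V Λ ηplus jstar K)) := by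
  have hρbar0 : 0 ≤ ρbar := le_trans (Finset.sum_nonneg fun b _ => hρ 0 b) (hρbar 0 0)
  have hσ0 : 0 ≤ Real.exp (ηplus - κ₁) := (Real.exp_pos _).le
  have hCst : 0 ≤ ρbar * Real.exp (-κ₁) := mul_nonneg hρbar0 (Real.exp_pos _).le
  have hq : ∀ K, ∀ s ∈ bliveSlots Cell (runFam Lren Lmer Lpart Lroot Ncap) K, 0 ≤ bslotPrice (y K) s := by
    intro K s hs
    obtain ⟨j, z, G⟩ := s
    simp only [bliveSlots, Finset.mem_sigma, Finset.mem_range] at hs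
    exact hy0 K j (Nat.lt_succ_iff.1 hs.1) z hs.2.1 G hs.2.2
  have hslot : ∀ K, K₀ ≤ K → ∀ j ≤ K, ∀ z ∈ Cell K (K - j),
      ∑ G ∈ runFam Lren Lmer Lpart Lroot Ncap K j, y K j z G ≤
        ρbar * Real.exp (-κ₁) * Real.exp (ηplus - κ₁) ^ (K - j) :=
    fun K hK j hjK z hz => bslotPriceT_le (Lren K) (Lmer K) (Lpart K) st (hst K) (η K) (hη K) hθ hηplus (ha K)
      (hμ K) (hν K) h1 hx (Ncap K) (ρ K) (hρ K) (Lroot K j) (hρbar K j) hjK (y K j z) (hyT K hK j hjK z hz)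
  have hmold0 : ∀ K, 0 ≤ ρbar * Real.exp (-κ₁) * V *
      ((Λ * Real.exp (ηplus - κ₁)) ^ (K - jstar K + 1) / (1 - Λ * Real.exp (ηplus - κ₁))) := by
    intro K
    have hσ0' : 0 ≤ Λ * Real.exp (ηplus - κ₁) := mul_nonneg hΛ.le hσ0
    have h1' : 0 < 1 - Λ * Real.exp (ηplus - κ₁) := by linarith
    exact mul_nonneg (mul_nonneg hCst hV) (div_nonneg (pow_nonneg hσ0' _) h1'.le)
  exact exists_relWeightBound_of_regeneration_liveGas (fun K => bliveSlots Cell (runFam Lren Lmer Lpart Lroot Ncap) K)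
    (fun K => boldSlots Cell (runFam Lren Lmer Lpart Lroot Ncap) jstar K)
    (fun K => boldSlots_subset_bliveSlots Cell _ (hj K)) (fun K => bslotPrice (y K)) hq str hinj hstr
    (mold := fun K => ρbar * Real.exp (-κ₁) * V *
      ((Λ * Real.exp (ηplus - κ₁)) ^ (K - jstar K + 1) / (1 - Λ * Real.exp (ηplus - κ₁))))
    (mlive := fun K => ρbar * Real.exp (-κ₁) * V * (1 / (1 - Λ * Real.exp (ηplus - κ₁))))
    hmold0
    (fun K hK => boldMass_le_of_slotBound Cell hV hΛ.le hCst hσ0 hr (hcell K) _ (hj K) (y K)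
      fun j hjlt z hz => hslot K hK j ((le_of_lt hjlt).trans (hj K)) z hz)
    (fun K hK => bliveMass_le_of_slotBound Cell hV hΛ.le hCst hσ0 hr (hcell K) _ (y K) (hslot K hK))
    (summable_recordsBudget hρbar0 hV hΛ hr hc hfrac) hA hA' hF hF' hCn

end Run

/-! ## §6 From the banked price to the telescoped tree shape: the generic bridge, and the seam on the dictionary -/

section Bridge

variable {ε : Type*}

/-- the product of the window factors is the exponential of the window sum [folklore] -/
theorem prod_expWindow_eq (κ₁ : ℝ) (W : ε → ℕ) (S : Finset ε) :
    ∏ e ∈ S, Real.exp (-(κ₁ * (W e : ℝ))) = Real.exp (-(κ₁ * ((∑ e ∈ S, W e : ℕ) : ℝ))) := by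
  rw [← Real.exp_sum]
  congr 1
  push_cast
  rw [Finset.mul_sum, ← Finset.sum_neg_distrib]

variable [DecidableEq ε]

/-- **THE GENERIC BRIDGE — RAW SHAPE × `M^{partnerAges}` IS A TELESCOPED TREE PRICE.**  For a well-formed genealogy
`G` pending at `K` (`K < reach`) whose partner ages are at most its window surplus, `0 ≤ κ₁`, `0 ≤ M`, `0 ≤ ρ (root G)`,
`η > 0`: a price `y ≤ M^{partnerAges}·(ρ root·e^{−κ₁ W root}·∏_{events ∖ root} (e^{−κ₁ W e}·η e))` obeys
`y ≤ e^{−κ₁ (K + 1 − rootStep G)}·treeWt ρ η (M·e^{−κ₁}) st G`.  The window credits telescope over the pending span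
(`T4PartnerMultiplicity.span_add_windowSurplus_le`); the SURPLUS credits — discarded by the records count and only used
to KILL `Λ′` in `T4PartnerMultiplicity.mulFactor_le` (`Λ′e^{−κ₁} ≤ 1`) — are now CARRIED as the age factor
`θ = M·e^{−κ₁}`, with no smallness asked of `M`. [folklore] -/
theorem treeShape_of_mulRawShape {W st : ε → ℕ} {ρ η : ε → ℝ} {κ₁ M : ℝ} (hκ : 0 ≤ κ₁) (hM : 0 ≤ M) {G : Gen ε}
    (hW : G.WF W) (hρ : 0 ≤ ρ G.root) (hη : ∀ e, 0 < η e) {K : ℕ} (hK : K < G.reach W)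
    (hsur : partnerAges st G ≤ windowSurplus W G) {y : ℝ}
    (hy : y ≤ M ^ partnerAges st G * (ρ G.root * Real.exp (-(κ₁ * W G.root)) *
      ∏ e ∈ G.events.erase G.root, (Real.exp (-(κ₁ * W e)) * η e))) :
    y ≤ Real.exp (-(κ₁ * ((K + 1 - G.rootStep : ℕ) : ℝ))) * treeWt ρ η (M * Real.exp (-κ₁)) st G := by
  have hP : ∏ e ∈ G.events.erase G.root, η e = npNR η G := (npNR_eq_prod_erase η W hW (hη G.root).ne').symm
  have hP0 : 0 ≤ npNR η G := npNR_nonneg (fun e => (hη e).le) G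
  have hraw : ρ G.root * Real.exp (-(κ₁ * W G.root)) * ∏ e ∈ G.events.erase G.root, (Real.exp (-(κ₁ * W e)) * η e)
      = ρ G.root * Real.exp (-(κ₁ * ((∑ e ∈ G.events, W e : ℕ) : ℝ))) * npNR η G := by
    rw [Finset.prod_mul_distrib, hP, ← prod_expWindow_eq,
      ← Finset.mul_prod_erase G.events (fun e => Real.exp (-(κ₁ * (W e : ℝ)))) (Gen.root_mem G)]
    ring
  have hspan : (K + 1 - G.rootStep) + partnerAges st G ≤ ∑ e ∈ G.events, W e :=
    le_trans (Nat.add_le_add_left hsur _) (span_add_windowSurplus_le W hW hK)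
  have hcast : ((K + 1 - G.rootStep : ℕ) : ℝ) + (partnerAges st G : ℝ) ≤ ((∑ e ∈ G.events, W e : ℕ) : ℝ) := by
    exact_mod_cast hspan
  have hexp : Real.exp (-(κ₁ * ((∑ e ∈ G.events, W e : ℕ) : ℝ))) ≤
      Real.exp (-(κ₁ * ((K + 1 - G.rootStep : ℕ) : ℝ))) * Real.exp (-κ₁) ^ partnerAges st G := by
    rw [← Real.exp_nat_mul, ← Real.exp_add]
    exact Real.exp_le_exp.2 (by nlinarith [mul_le_mul_of_nonneg_left hcast hκ])
  calc y ≤ M ^ partnerAges st G * (ρ G.root * Real.exp (-(κ₁ * ((∑ e ∈ G.events, W e : ℕ) : ℝ))) * npNR η G) := by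
        rw [← hraw]; exact hy
    _ ≤ M ^ partnerAges st G * (ρ G.root * (Real.exp (-(κ₁ * ((K + 1 - G.rootStep : ℕ) : ℝ))) *
          Real.exp (-κ₁) ^ partnerAges st G) * npNR η G) :=
        mul_le_mul_of_nonneg_left (mul_le_mul_of_nonneg_right (mul_le_mul_of_nonneg_left hexp hρ) hP0)
          (pow_nonneg hM _)
    _ = Real.exp (-(κ₁ * ((K + 1 - G.rootStep : ℕ) : ℝ))) * treeWt ρ η (M * Real.exp (-κ₁)) st G := by
        rw [treeWt, mul_pow]; ring

variable {C : T4PrintedShapeBanking.Consts} {K : ℕ} {R : ℕ → ℕ} {g : ℕ → ℝ}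

/-- **THE SEAM ON THE DICTIONARY, ONE GENEALOGY.**  If the printed shapes inhabit `Banking` at cutoff `K` along the run
`(R, g)`, `0 ≤ C.κ₁`, `0 ≤ Λ′`, then a price `y` that is either `≤ 0` or at most `Λ′^{partnerAges G}` times the raw factor
`e^{−credits G}·e^{+lifeCost G}` of a CONSISTENT, well-formed genealogy `G` pending at `K` obeys the telescoped tree shape
`y ≤ e^{−C.κ₁ (K + 1 − rootStep G)}·treeWt (rho C g) (eta C) (Λ′·e^{−C.κ₁}) PEv.step G` —
`T4RecordPriceSeam.price_le_shape` + `T4PartnerMultiplicity.partnerAges_le_windowSurplus` + the generic bridge.  NO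
condition `Λ′·e^{−C.κ₁} ≤ 1`. [folklore] -/
theorem treeShape_of_labelB (hκ : 0 ≤ C.κ₁)
    (hBk : Banking (Consistent C K R) (dictW R C.n₁) (cost C K R) (credit C g)
      (fun e => C.κ₁ * ((dictW R C.n₁ e : ℕ) : ℝ) + Emarg C e) (reserve C g) (extn C K R))
    {Λ' : ℝ} (hΛ0 : 0 ≤ Λ') {y : ℝ} {G : Gen PEv}
    (hlabB : y ≤ 0 ∨ (Consistent C K R G ∧ G.WF (dictW R C.n₁) ∧ K < G.reach (dictW R C.n₁) ∧
      y ≤ Λ' ^ partnerAges PEv.step G *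
        (Real.exp (-credits (credit C g) G) * Real.exp (lifeCost (dictW R C.n₁) (cost C K R) G)))) :
    y ≤ Real.exp (-(C.κ₁ * ((K + 1 - G.rootStep : ℕ) : ℝ))) *
      treeWt (rho C g) (eta C) (Λ' * Real.exp (-C.κ₁)) PEv.step G := by
  rcases hlabB with h | ⟨hc, hW, hK, hy⟩
  · exact h.trans (mul_nonneg (Real.exp_pos _).le (treeWt_nonneg (fun b => (rho_pos C g b).le)
      (fun e => (eta_pos C e).le) (mul_nonneg hΛ0 (Real.exp_pos _).le) PEv.step G))
  · have hshape := price_le_shape hBk (Or.inr ⟨G, hc, hW, rfl, rfl, le_rfl⟩)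
    exact treeShape_of_mulRawShape hκ hΛ0 hW (rho_pos C g _).le (eta_pos C) hK (partnerAges_le_windowSurplus hc)
      (hy.trans (mul_le_mul_of_nonneg_left hshape (pow_nonneg hΛ0 _)))

/-- **THE CLASS SHAPE OF AN EVENT**: the count's label.  A birth keeps its fatness class (its weight depends on it); a
renewal or merger keeps only `(step, kind)` — its class coordinate is a tag the weights `rho`, `eta` ignore
(`T4RecordPriceSeam` §4 REMARK), so the count books ONE label `(t, 1, 0)` / `(t, 2, 0)` per step. [folklore] -/
def shape (e : PEv) : PEv := (e.step, e.kind, if e.kind = 0 then e.fat else 0)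

/-- the shape keeps the step [folklore] -/
@[simp] theorem step_shape (e : PEv) : PEv.step (shape e) = PEv.step e := rfl
/-- the shape keeps the kind [folklore] -/
@[simp] theorem kind_shape (e : PEv) : PEv.kind (shape e) = PEv.kind e := rfl
/-- the shape keeps a birth's class [folklore] -/
theorem fat_shape_of_kind0 {e : PEv} (h : e.kind = 0) : PEv.fat (shape e) = PEv.fat e := by
  simp [shape, PEv.fat, h]

/-- the bank margin depends only on the shape [folklore] -/
theorem Emarg_shape (C : T4PrintedShapeBanking.Consts) (e : PEv) : Emarg C (shape e) = Emarg C e := by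
  by_cases h : e.kind = 0
  · rw [Emarg_kind0 (C := C) ((kind_shape e).trans h), Emarg_kind0 (C := C) h, fat_shape_of_kind0 h]
  · unfold Emarg; simp [h]

/-- the reserve depends only on the shape [folklore] -/
theorem reserve_shape (C : T4PrintedShapeBanking.Consts) (g : ℕ → ℝ) (e : PEv) :
    reserve C g (shape e) = reserve C g e := by
  unfold reserve; simp

/-- `rho` depends only on the shape [folklore] -/
@[simp] theorem rho_shape (C : T4PrintedShapeBanking.Consts) (g : ℕ → ℝ) (e : PEv) :
    rho C g (shape e) = rho C g e := by
  rw [rho_eq, rho_eq, Emarg_shape, reserve_shape]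

/-- `eta` depends only on the shape [folklore] -/
@[simp] theorem eta_shape (C : T4PrintedShapeBanking.Consts) (e : PEv) : eta C (shape e) = eta C e := by
  rw [eta_eq, eta_eq, Emarg_shape]

/-- the tree weight of the model is read off the shapes [folklore] -/
theorem treeWt_relabel_shape (C : T4PrintedShapeBanking.Consts) (g : ℕ → ℝ) (θ : ℝ) (G : Gen PEv) :
    treeWt (rho C g) (eta C) θ PEv.step (relabel shape G) = treeWt (rho C g) (eta C) θ PEv.step G := by
  rw [treeWt_relabel shape (rho C g) (eta C) θ (st := PEv.step) (fun e => step_shape e)]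
  simp only [rho_shape, eta_shape]

/-- **THE SEAM ON THE DICTIONARY, ONE BRANCHING SLOT** — the labelling binder `hlabB` of §7 at one slot: the price at
the branching record `G` (a genealogy term over SHAPES) is either `≤ 0` or at most `Λ′^{partnerAges G̃}` × the raw factor of
SOME consistent well-formed genealogy `G̃` over the dictionary's events, pending at `K`, whose shape-relabelling is `G`;
then `y ≤ e^{−C.κ₁ (K + 1 − rootStep G)}·treeWt (rho C g) (eta C) (Λ′·e^{−C.κ₁}) PEv.step G`. [folklore] -/
theorem treeShape_of_label (hκ : 0 ≤ C.κ₁)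
    (hBk : Banking (Consistent C K R) (dictW R C.n₁) (cost C K R) (credit C g)
      (fun e => C.κ₁ * ((dictW R C.n₁ e : ℕ) : ℝ) + Emarg C e) (reserve C g) (extn C K R))
    {Λ' : ℝ} (hΛ0 : 0 ≤ Λ') {y : ℝ} {G : Gen PEv}
    (hlab : y ≤ 0 ∨ ∃ G' : Gen PEv, Consistent C K R G' ∧ G'.WF (dictW R C.n₁) ∧ K < G'.reach (dictW R C.n₁) ∧
      relabel shape G' = G ∧ y ≤ Λ' ^ partnerAges PEv.step G' *
        (Real.exp (-credits (credit C g) G') * Real.exp (lifeCost (dictW R C.n₁) (cost C K R) G'))) :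
    y ≤ Real.exp (-(C.κ₁ * ((K + 1 - G.rootStep : ℕ) : ℝ))) *
      treeWt (rho C g) (eta C) (Λ' * Real.exp (-C.κ₁)) PEv.step G := by
  rcases hlab with h | ⟨G', hc, hW, hK, hG, hy⟩
  · exact h.trans (mul_nonneg (Real.exp_pos _).le (treeWt_nonneg (fun b => (rho_pos C g b).le)
      (fun e => (eta_pos C e).le) (mul_nonneg hΛ0 (Real.exp_pos _).le) PEv.step G))
  · have h := treeShape_of_labelB hκ hBk hΛ0 (Or.inr ⟨hc, hW, hK, hy⟩)
    rw [← hG, rootStep_relabel, treeWt_relabel_shape]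
    exact h

end Bridge

/-! ## §7 End to end on the dictionary: typed flow + infrared smallness + prices labelled by branching records +
regeneration runs ⇒ `RelWeightBound`, same root rate, same budget shape -/

section EndToEnd

variable {γ κ ι : Type*} [DecidableEq γ] [DecidableEq κ] {l₀ : ℝ} {K₀ : ℕ} {π : ℕ → ι → κ} {T : ℕ → Finset ι}
  {A A' : ℕ → ℝ → ι → ℝ} {Bad' : ℕ → ℝ → Finset κ} {dead dead' : ℕ → ℝ → ι → ℝ} {F Rf F' Rf' : ℕ → κ → ℝ}
  {nlow nup mlow mup : ℕ → ℝ → ℝ} {Cn : ℝ}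

/-- **`Banking` ALONG A FAMILY OF RUNS + PRICES LABELLED BY BRANCHING RECORDS + THE BRANCHING RECORDS GAS ⇒ THE
WEIGHT SLOT.**  `T4PartnerMultiplicity.exists_relWeightBound_of_bankingM` with the live index set replaced by the
branching slots over the menus `Lroot`, `Lren`, `Lmer`, `Lpart` (per cutoff; fuel `Ncap`), the labelling binder replaced by
`hlabB` (one slot: `treeShape_of_label`), the budgets `ρ̄` (roots), `a` (renewals per step), `μ` (mergers per step), `ν`
(partner births per step) displayed, the age factor `θ = Λ′·e^{−C.κ₁}` with `θ·e^{η̄₊} < 1` and the fixed-point side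
condition displayed, and the ROOT RATE `Λ·e^{η̄₊ − C.κ₁} < 1`; conclusion `∃ K₁ ≥ K₀`, the kernel's term-level
`RelWeightBound` with budget `𝟙·C·recordsBudget ρ̄ C.κ₁ V Λ η̄₊ j⋆`.  The condition `Λ′·e^{−C.κ₁} ≤ 1` of the
multiplicity seam is GONE. [folklore] -/
theorem exists_relWeightBound_of_bankingB {C : T4PrintedShapeBanking.Consts} (hκ : 0 ≤ C.κ₁) (R : ℕ → ℕ → ℕ)
    (g : ℕ → ℕ → ℝ)
    (hBk : ∀ K, K₀ ≤ K → Banking (Consistent C K (R K)) (dictW (R K) C.n₁) (cost C K (R K)) (credit C (g K))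
      (fun e => C.κ₁ * ((dictW (R K) C.n₁ e : ℕ) : ℝ) + Emarg C e) (reserve C (g K)) (extn C K (R K)))
    (Cell : ℕ → ℕ → Finset γ) {V Λ : ℝ} (hV : 0 ≤ V) (hΛ : 0 < Λ)
    (hcell : ∀ K a, ((Cell K a).card : ℝ) ≤ V * Λ ^ a)
    (Lren Lmer Lpart Lroot : ℕ → ℕ → Finset PEv) (Ncap : ℕ → ℕ)
    (hst : ∀ K t, ∀ e ∈ Lmer K t, PEv.step e = t) {ρbar a μ ν ηplus : ℝ}
    (hρbar : ∀ K j, ∑ b ∈ Lroot K j, rho C (g K) b ≤ ρbar) (ha : ∀ K t, ∑ e ∈ Lren K t, eta C e ≤ a)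
    (hμ : ∀ K t, ∑ e ∈ Lmer K t, eta C e ≤ μ) (hν : ∀ K s, ∑ b ∈ Lpart K s, eta C b ≤ ν) (hηplus : 0 ≤ ηplus)
    (hr : Λ * Real.exp (ηplus - C.κ₁) < 1) {Λ' : ℝ} (hΛ0 : 0 ≤ Λ')
    (h1 : Λ' * Real.exp (-C.κ₁) * Real.exp ηplus < 1)
    (hx : (a + μ * ν * (Λ' * Real.exp (-C.κ₁) / (1 - Λ' * Real.exp (-C.κ₁) * Real.exp ηplus))) * Real.exp ηplus ≤
      Real.exp ηplus - 1)
    (jstar : ℕ → ℕ) (hj : ∀ K, jstar K ≤ K) {c : ℝ} (hc : 0 < c)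
    (hfrac : ∀ K : ℕ, c * K ≤ ((K - jstar K : ℕ) : ℝ)) (y : ℕ → ℕ → γ → Gen PEv → ℝ)
    (hy0 : ∀ K, ∀ j ≤ K, ∀ z ∈ Cell K (K - j), ∀ G ∈ runFam Lren Lmer Lpart Lroot Ncap K j, 0 ≤ y K j z G)
    (hlabB : ∀ K, K₀ ≤ K → ∀ j ≤ K, ∀ z ∈ Cell K (K - j), ∀ G ∈ runFam Lren Lmer Lpart Lroot Ncap K j,
      y K j z G ≤ 0 ∨ ∃ G' : Gen PEv, Consistent C K (R K) G' ∧ G'.WF (dictW (R K) C.n₁) ∧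
        K < G'.reach (dictW (R K) C.n₁) ∧ relabel shape G' = G ∧
        y K j z G ≤ Λ' ^ partnerAges PEv.step G' * (Real.exp (-credits (credit C (g K)) G') *
          Real.exp (lifeCost (dictW (R K) C.n₁) (cost C K (R K)) G')))
    (str : ℕ → κ → Finset (BSlot γ PEv))
    (hinj : ∀ K t, |t| ≤ l₀ → K₀ ≤ K → Set.InjOn (str K) (Bad' K t))
    (hstr : ∀ K t, |t| ≤ l₀ → K₀ ≤ K → ∀ c ∈ Bad' K t,
      str K c ⊆ bliveSlots Cell (runFam Lren Lmer Lpart Lroot Ncap) K ∧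
        ∃ o ∈ boldSlots Cell (runFam Lren Lmer Lpart Lroot Ncap) jstar K, o ∈ str K c)
    (hA : Regeneration l₀ π T A Bad' dead F Rf nlow nup Cn K₀)
    (hA' : Regeneration l₀ π T A' Bad' dead' F' Rf' mlow mup Cn K₀)
    (hF : ∀ K t, |t| ≤ l₀ → K₀ ≤ K → ∀ c ∈ Bad' K t, F K c * Rf K c ≤ famWeight (bslotPrice (y K)) (str K c))
    (hF' : ∀ K t, |t| ≤ l₀ → K₀ ≤ K → ∀ c ∈ Bad' K t, F' K c * Rf' K c ≤ famWeight (bslotPrice (y K)) (str K c))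
    (hCn : 0 ≤ Cn) :
    ∃ K₁, K₀ ≤ K₁ ∧ RelWeightBound l₀ T A A' (fun K t => if K₁ ≤ K then badOfClass π T Bad' K t else ∅)
      (Set.indicator {K | K₁ ≤ K} (fun K => Cn * recordsBudget ρbar C.κ₁ V Λ ηplus jstar K)) :=
  exists_relWeightBound_of_regeneration_branchingGasRun Cell hV hΛ hcell Lren Lmer Lpart Lroot Ncap PEv.step hst
    (fun K => rho C (g K)) (fun _ => eta C) (fun K b => (rho_pos C (g K) b).le) (fun _ e => (eta_pos C e).le) hρbar
    ha hμ hν (mul_nonneg hΛ0 (Real.exp_pos _).le) hηplus h1 hx hr jstar hj hc hfrac y hy0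
    (fun K hK j hjK z hz G hG => by
      have h := treeShape_of_label hκ (hBk K hK) hΛ0 (hlabB K hK j hjK z hz G hG)
      rwa [rootStep_of_mem_fam (Lren := Lren K) (Lmer := Lmer K) (Lpart := Lpart K) (Ncap K) (Lroot K j) j K G hG] at h)
    str hinj hstr hA hA' hF hF' hCn

/-- **END TO END WITH BRANCHING RECORDS — ONE INFRARED THRESHOLD, THEN THE WEIGHT SLOT.**
`T4PartnerMultiplicity.exists_irThreshold_relWeightBoundM` with the same replacements: for valid symbolic constants with
`a, A₀ > 0`, `L ≥ 1`, `β₀ ≥ 0`, `r(q′+1) < p₀` there is ONE number `x₀` (`T4PrintedShapeBanking.exists_irThreshold`) such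
that for EVERY family of runs obeying typed (2.7), (2.9), (2.5), `1 ≤ log g_{K,s}⁻²`, `x₀ ≤ log g_{K,K}⁻²` from `K₀` on,
every menu datum with its four budgets, every age datum `Λ′ ≥ 0` with `Λ′e^{−C.κ₁}·e^{η̄₊} < 1` and the fixed-point side
condition, the root rate `Λ·e^{η̄₊ − C.κ₁} < 1`, prices labelled by branching records (`hlabB`) and two regeneration runs:
`∃ K₁ ≥ K₀` with the kernel's term-level `RelWeightBound`, budget `𝟙·C·recordsBudget ρ̄ C.κ₁ V Λ η̄₊ j⋆`.  The count
member's chain as ONE statement; its binders are the census of what is not kernel. [folklore] -/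
theorem exists_irThreshold_relWeightBoundB (C : T4PrintedShapeBanking.Consts) (hC : C.Valid) (ha₀ : 0 < C.a)
    (hA₀ : 0 < C.A₀) {L r : ℕ} (hL : 1 ≤ L) {β₀ : ℝ} (hβ : 0 ≤ β₀) (hrq : r * (C.q' + 1) < C.p₀)
    (Cell : ℕ → ℕ → Finset γ) {V Λ : ℝ} (hV : 0 ≤ V) (hΛ : 0 < Λ)
    (hcell : ∀ K a, ((Cell K a).card : ℝ) ≤ V * Λ ^ a)
    (Lren Lmer Lpart Lroot : ℕ → ℕ → Finset PEv) (Ncap : ℕ → ℕ)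
    (hst : ∀ K t, ∀ e ∈ Lmer K t, PEv.step e = t) (jstar : ℕ → ℕ) (hj : ∀ K, jstar K ≤ K) {c : ℝ} (hc : 0 < c)
    (hfrac : ∀ K : ℕ, c * K ≤ ((K - jstar K : ℕ) : ℝ))
    (hA : Regeneration l₀ π T A Bad' dead F Rf nlow nup Cn K₀)
    (hA' : Regeneration l₀ π T A' Bad' dead' F' Rf' mlow mup Cn K₀) (hCn : 0 ≤ Cn) :
    ∃ x₀ : ℝ, ∀ (R : ℕ → ℕ → ℕ) (g : ℕ → ℕ → ℝ) (β' : ℕ → ℝ),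
      (∀ K, K₀ ≤ K → B14.FlowIneq27 (g K) (β' K) β₀ C.p₀ K) →
      (∀ K, K₀ ≤ K → B14FlowStep.FlowIneq29 (R K) (g K) L (β' K) β₀ K) →
      (∀ K, K₀ ≤ K → ∀ s, s ≤ K → B14.IsRj L r (g K s) (R K s)) →
      (∀ K, K₀ ≤ K → ∀ s, s ≤ K → 1 ≤ Real.log ((g K s) ^ 2)⁻¹) →
      (∀ K, K₀ ≤ K → x₀ ≤ Real.log ((g K K) ^ 2)⁻¹) →
      ∀ {ρbar a μ ν ηplus : ℝ}, (∀ K j, ∑ b ∈ Lroot K j, rho C (g K) b ≤ ρbar) →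
      (∀ K t, ∑ e ∈ Lren K t, eta C e ≤ a) → (∀ K t, ∑ e ∈ Lmer K t, eta C e ≤ μ) →
      (∀ K s, ∑ b ∈ Lpart K s, eta C b ≤ ν) → 0 ≤ ηplus →
      Λ * Real.exp (ηplus - C.κ₁) < 1 →
      ∀ {Λ' : ℝ}, 0 ≤ Λ' → Λ' * Real.exp (-C.κ₁) * Real.exp ηplus < 1 →
      (a + μ * ν * (Λ' * Real.exp (-C.κ₁) / (1 - Λ' * Real.exp (-C.κ₁) * Real.exp ηplus))) * Real.exp ηplus ≤
        Real.exp ηplus - 1 →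
      ∀ (y : ℕ → ℕ → γ → Gen PEv → ℝ),
      (∀ K, ∀ j ≤ K, ∀ z ∈ Cell K (K - j), ∀ G ∈ runFam Lren Lmer Lpart Lroot Ncap K j, 0 ≤ y K j z G) →
      (∀ K, K₀ ≤ K → ∀ j ≤ K, ∀ z ∈ Cell K (K - j), ∀ G ∈ runFam Lren Lmer Lpart Lroot Ncap K j,
        y K j z G ≤ 0 ∨ ∃ G' : Gen PEv, Consistent C K (R K) G' ∧ G'.WF (dictW (R K) C.n₁) ∧
          K < G'.reach (dictW (R K) C.n₁) ∧ relabel shape G' = G ∧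
          y K j z G ≤ Λ' ^ partnerAges PEv.step G' * (Real.exp (-credits (credit C (g K)) G') *
            Real.exp (lifeCost (dictW (R K) C.n₁) (cost C K (R K)) G'))) →
      ∀ (str : ℕ → κ → Finset (BSlot γ PEv)),
      (∀ K t, |t| ≤ l₀ → K₀ ≤ K → Set.InjOn (str K) (Bad' K t)) →
      (∀ K t, |t| ≤ l₀ → K₀ ≤ K → ∀ c ∈ Bad' K t,
        str K c ⊆ bliveSlots Cell (runFam Lren Lmer Lpart Lroot Ncap) K ∧
          ∃ o ∈ boldSlots Cell (runFam Lren Lmer Lpart Lroot Ncap) jstar K, o ∈ str K c) →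
      (∀ K t, |t| ≤ l₀ → K₀ ≤ K → ∀ c ∈ Bad' K t, F K c * Rf K c ≤ famWeight (bslotPrice (y K)) (str K c)) →
      (∀ K t, |t| ≤ l₀ → K₀ ≤ K → ∀ c ∈ Bad' K t, F' K c * Rf' K c ≤ famWeight (bslotPrice (y K)) (str K c)) →
      ∃ K₁, K₀ ≤ K₁ ∧ RelWeightBound l₀ T A A' (fun K t => if K₁ ≤ K then badOfClass π T Bad' K t else ∅)
        (Set.indicator {K | K₁ ≤ K} (fun K => Cn * recordsBudget ρbar C.κ₁ V Λ ηplus jstar K)) := by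
  obtain ⟨x₀, hx₀⟩ := exists_irThreshold C hC ha₀ hA₀ hL hβ hrq
  refine ⟨x₀, ?_⟩
  intro R g β' h27 h29 hR hx1 hir ρbar a μ ν ηplus hρbar ha hμ hν hηplus hr Λ' hΛ0 h1 hx y hy0 hlabB str hinj hstr
    hF hF'
  exact exists_relWeightBound_of_bankingB hC.κ₁_nonneg R g
    (fun K hK => hx₀ K (R K) (g K) (β' K) (h27 K hK) (h29 K hK) (hR K hK) (hx1 K hK) (hir K hK))
    Cell hV hΛ hcell Lren Lmer Lpart Lroot Ncap hst hρbar ha hμ hν hηplus hr hΛ0 h1 hx jstar hj hc hfrac y hy0 hlabB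
    str hinj hstr hA hA' hF hF' hCn

end EndToEnd

/-! ## §8 Sanity: a two-branch history with SIMULTANEOUS SAME-LABEL renewals is a branching record (and is NOT a
well-formed genealogy — the flat records count could not book it); its tree weight; the side conditions at numbers -/

section Sanity

namespace Sanity

/-- the renewal menu of the sanity run: one label `(t, 1, 0)` per step [folklore] -/
def Lren (t : ℕ) : Finset PEv := {((t, 1, 0) : PEv)}
/-- the merger menu: one label `(t, 2, 0)` per step [folklore] -/
def Lmer (t : ℕ) : Finset PEv := {((t, 2, 0) : PEv)}
/-- the partner menu: thin births `(s, 0, 0)` [folklore] -/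
def Lpart (s : ℕ) : Finset PEv := {((s, 0, 0) : PEv)}
/-- the root menu: one birth of class `1` at step `0` [folklore] -/
def Lb : Finset PEv := {((0, 0, 1) : PEv)}
/-- main line: born at `0` (class `1`), renewed at step `3` [folklore] -/
def X : Gen PEv := Gen.renew (Gen.born (0, 0, 1) 0) (3, 1, 0) 2
/-- partner line: born at `1` (class `0`), renewed at the SAME step `3` with the SAME label [folklore] -/
def Y : Gen PEv := Gen.renew (Gen.born (1, 0, 0) 1) (3, 1, 0) 2
/-- the two lines merge at step `4`; the merged structure is renewed at step `6` [folklore] -/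
def Z : Gen PEv := Gen.renew (Gen.merge X Y (4, 2, 0)) (6, 1, 0) 5

/-- the bare root birth is a record of every positive fuel, whatever the event horizon (the fuel is kept SYMBOLIC,
`n + 1`: on a closed numeral the elaborator unfolds `fam`) [folklore] -/
theorem broot_mem (n K : ℕ) : Gen.born ((0, 0, 1) : PEv) 0 ∈ fam Lren Lmer Lpart (n + 1) Lb 0 K :=
  born_mem_fam (by simp [Lb])

/-- the bare partner birth at step `1` from the partner menu [folklore] -/
theorem partner_mem (n K : ℕ) : Gen.born ((1, 0, 0) : PEv) 1 ∈ fam Lren Lmer Lpart (n + 1) (Lpart 1) 1 K :=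
  born_mem_fam (by simp [Lpart])

/-- the main line with events `≤ 4` is a record of fuel `≤ n + 2` [folklore] -/
theorem X_mem (n : ℕ) : X ∈ fam Lren Lmer Lpart (n + 2) Lb 0 4 :=
  renew_mem_fam (t := 3) (by simp) (by simp [Lren]) (broot_mem n 3)

/-- the partner line, born at `1` from the partner menu, with events `≤ 4` [folklore] -/
theorem Y_mem (n : ℕ) : Y ∈ fam Lren Lmer Lpart (n + 2) (Lpart 1) 1 4 :=
  renew_mem_fam (t := 3) (by simp) (by simp [Lren]) (partner_mem n 3)

/-- the merger at step `4` of the two lines (partner born at `1 ∈ [0, 4]`) is a record with events `≤ 6` [folklore] -/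
theorem XY_mem (n : ℕ) : Gen.merge X Y (4, 2, 0) ∈ fam Lren Lmer Lpart (n + 3) Lb 0 6 :=
  merge_mem_fam (t := 4) (by simp) (by simp [Lmer]) (s' := 1) (by simp) (X_mem n) (Y_mem n)

/-- **THE TWO-BRANCH HISTORY WITH SIMULTANEOUS SAME-LABEL RENEWALS IS COUNTED**: `Z ∈ fam (n + 4) Lb 0 8`.
[folklore] -/
theorem Z_mem (n : ℕ) : Z ∈ fam Lren Lmer Lpart (n + 4) Lb 0 8 :=
  renew_mem_fam (t := 6) (by simp) (by simp [Lren]) (XY_mem n)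

/-- … although it is NOT a well-formed genealogy for ANY window table (the label `(3, 1, 0)` occurs in both branches —
symptom (i) of the flat count, G-ne7bp1g12-1 (LM)). [folklore] -/
theorem Z_not_WF (W : PEv → ℕ) : ¬ Z.WF W := by
  intro h
  simp [Z, X, Y, Gen.WF, Gen.events] at h

/-- its tree weight: root residual of `(0,0,1)`, age factor `θ^4` (the partner born at `1` merging at `4`), and the
residual of EVERY non-root node, the repeated label twice [folklore] -/
example (ρ η : PEv → ℝ) (θ : ℝ) : treeWt ρ η θ PEv.step Z =
    ρ (0, 0, 1) * θ ^ 4 * (η (3, 1, 0) * (η (1, 0, 0) * η (3, 1, 0)) * η (4, 2, 0) * η (6, 1, 0)) := by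
  simp only [treeWt, Z, X, Y, npNR_renew, npNR_merge, npNR_born, npAll_renew, npAll_born, partnerAges_renew,
    partnerAges_merge, partnerAges_born, root_renew, root_merge, root_born, Gen.rootStep_renew, Gen.rootStep_born,
    PEv.step_mk]
  norm_num

/-- the menus' budgets in the model: `a = μ = e^{−E₀}` (`T4RecordPriceSeam.eta_renew/eta_merge`) [folklore] -/
example (C : T4PrintedShapeBanking.Consts) (t : ℕ) :
    ∑ e ∈ Lren t, eta C e = Real.exp (-C.E₀) ∧ ∑ e ∈ Lmer t, eta C e = Real.exp (-C.E₀) := by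
  simp [Lren, Lmer, eta_renew, eta_merge]

/-- the merger menu's labels sit at their step (the binder `hst`) [folklore] -/
example : ∀ t, ∀ e ∈ Lmer t, PEv.step e = t := by simp [Lmer]

/-- the side conditions at numbers: `a = μ = ν = θ = 1/10`, `φ = e^{η̄₊} = 2`: `θφ = 1/5 < 1` and
`(a + μν·θ/(1 − θφ))·φ = 0.2025 ≤ 1 = φ − 1` [folklore] -/
example : (1 : ℝ) / 10 * Real.exp (Real.log 2) < 1 ∧
    ((1 : ℝ) / 10 + 1 / 10 * (1 / 10) * (1 / 10 / (1 - 1 / 10 * Real.exp (Real.log 2)))) * Real.exp (Real.log 2) ≤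
      Real.exp (Real.log 2) - 1 := by
  rw [Real.exp_log (by norm_num : (0 : ℝ) < 2)]
  norm_num

/-- **THE COUNT AT NUMBERS**: with `η ≡ 1/10`, `ρ ≡ 1`, `θ = 1/10`, `φ = 2` the branching records of fuel `≤ n` born at
`0` with events `≤ K` weigh at most `2^K` — for EVERY `n` and `K` (`famSum_le_exp`). [folklore] -/
example (n K : ℕ) :
    ∑ G ∈ fam Lren Lmer Lpart n Lb 0 K, treeWt (fun _ => (1 : ℝ)) (fun _ => (1 : ℝ) / 10) (1 / 10) PEv.step G ≤
      (2 : ℝ) ^ K := by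
  have h2 : Real.exp (Real.log 2) = 2 := Real.exp_log (by norm_num)
  have h := famSum_le_exp Lren Lmer Lpart PEv.step (by simp [Lmer]) (fun _ => (1 : ℝ) / 10) (fun _ => by norm_num)
    (a := 1 / 10) (μ := 1 / 10) (ν := 1 / 10) (θ := 1 / 10) (ηplus := Real.log 2) (by norm_num)
    (Real.log_nonneg (by norm_num)) (fun t => by simp [Lren]) (fun t => by simp [Lmer]) (fun s => by simp [Lpart])
    (by rw [h2]; norm_num) (by rw [h2]; norm_num) n (fun _ => (1 : ℝ)) (fun _ => zero_le_one) Lb 0 K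
  simpa [Lb, h2] using h

end Sanity

end Sanity

end T4BranchingRecordsGas

end Literature.MathematicalPhysics.QuantumFieldTheory.Balaban1983to89
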